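import Literature.NumberTheory.ConnesConsani2021.ArchimedeanTraceFormula
import Literature.NumberTheory.ConnesConsani2021.SeriesRemainderBounds
import Literature.NumberTheory.ConnesConsani2021.ScalingCoeffBoundaryTerms
import HarnessLib

/-!
# Connes–Consani 2021, §5 «The functional `E∘Q` and the compact operator `𝐊_I`»: Lemma 5.1, Lemma 5.2,
# Proposition 5.3 (the series for `Qε`), Lemma 5.4 (the slope `ε′(1₊)`), Remark 5.6 — STATEMENTS
# (named facts with locators) and the RH-free glue that is provable now

RH-FREE corpus literature (cell `rh-crit`, sub-cell cc, seat t5; bears_on: LADDER-RH W-C/W-P, apex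
input (B) `hG / hGe / he′` of `MainInequalityAssembly.weilArchPositivity_soninTrace_fine_of_spectralData`,
route items K0 `DensityRegular` / K2 `DensitySlope`).  WHAT THIS IS NOT: any claim about RH; a typed
§5 fixes which density `ε ∘ exp` enters the archimedean trace formula and what its slope at `0` is, it
does not move RH; positivity at the archimedean place alone never reaches the critical strip.  Nothing
in this file bears on the truth of RH.

A. Connes, C. Consani, *Weil positivity and trace formula, the archimedean place*, Selecta Math.
(N.S.) 27 (2021), Paper No. 77 = arXiv:2006.13771 [bib: `ConnesConsani2021`], **§5** (arXiv v1 PDF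
pp. 29–34; held text `paper:arxiv-2006.13771`, chunks p0019–p0021; TeX source
`cc/src/arXiv2006.13771-weil-compo.tex` l.1194–1423).  Printed (sectional) numbering = arXiv running
numbering (cell dictionary `cc/CC2021-NUMBERING-lit-1.md`): **Lemma 5.1** = item 28 (`devil1`, p. 29,
eq. (94)), **Lemma 5.2** = item 29 (`devil3`, pp. 29–30, eq. (96)), **Proposition 5.3** = item 30
(`propQe`, p. 32, eqs. (97) `qe`, (98) `sonineQ`, (99) `sonineQbis`), **Lemma 5.4** = item 31
(`epsilon'`, p. 32; eq. (100) `Rokh` and the printed values `t(0…4)`, `22.9965`, p. 33),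
**Proposition 5.5** = item 32 (`propcompact`, p. 33, eqs. (103) `quadform`, (104) `opkf`) — ALREADY in
the tree (below), **Remark 5.6** = item 33 (`traceki`, p. 34).  Other displays: (91) `E(f)` (p. 29),
(92) `kahane`, (93) `twocond` (p. 29), (95) `sonineconst1` (p. 30, "at the formal level"), (101)
`Eprimedef`, (102) `Eprime` (p. 33).  Prolate input quoted in (100): [Rokhlin–Xiao 2007, Thm. 12]
(bib `RokhlinXiao2007`, Appl. Comput. Harmon. Anal. 22 (2007), Thm. 12 p. 116) — asserted there WITHOUT
proof (bib `BonamiKaroui2014`, p. 230); not typed as a fact, see «The prolate input (100)» below.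

## What is printed (§5, pp. 29–34)

"Let `E` be the functional defined on `C_c^∞(ℝ₊*)` by (91) `E(f) := ∫ f(ρ⁻¹)ε(ρ)d*ρ`.  By Theorem 4.7
the functional `W_∞ + E` is positive. … The operator `𝒟 := D_u² + D_u`, where `D_u(f)(x) := x f′(x)`
is the scaling Hamiltonian, commutes with the Fourier transform `𝔽_{e_ℝ}` … One has (92)
`𝒟(f)(x) = x²f″(x) + 2xf′(x)` thus `𝒟(f)(0) = 0`.  Since `𝒟` commutes with the Fourier transform the
range `𝒟(𝒮(ℝ))` consists of functions fulfilling the two conditions (93) `f(0) = f̂(0) = 0`."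
**Lemma 5.1.** "Let `ξ, η ∈ L²(ℝ)_ev` be smooth functions.  Then with `Q` as in (55)
[`Q = −(ρ∂_ρ)² + ¼`] and `𝒟 := D_u² + D_u`, one has (94) `⟨η|ϑ(Qf)ξ⟩ = −⟨η|ϑ(f)𝒟ξ⟩`,
`∀ f ∈ C_c^∞(ℝ₊*)`."  (Proof: `⟨η|ϑ(Qf)ξ⟩ = ∫ Qf(ρ⁻¹)⟨η|ϑ(ρ⁻¹)ξ⟩d*ρ = ∫ f(ρ⁻¹)(Qk)(ρ)d*ρ`,
`k(ρ) := ⟨η|ϑ(ρ⁻¹)ξ⟩ = ρ^{1/2}∫ξ(ρx)η̄(x)dx`, and `Q(ρ^{1/2}ξ(ρx)) = −ρ^{1/2}(𝒟ξ)(ρx)`.)  "The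
integration by parts, which gives the adjoint of `D_u` as `−1 − D_u`, is
`∫_a^b D_u(f)(x)g(x)dx + ∫_a^b f(x)((1+D_u)g)(x)dx = b f(b)g(b) − a f(a)g(a)`" (p. 30).
**Lemma 5.2.** "Let `ξ ∈ C^∞((0,1])` and `ζ ∈ C^∞([1,∞))` be smooth and real valued functions.  Extend
first `ξ, ζ` to `[0,∞)` as follows: `ξ(x) := 0` for `x > 1` and `ζ(x) := 0` for `x < 1`.  Then, with `Q`
as in (55) and `k(ρ) = ρ^{1/2}∫_0^∞ ξ(x)ζ(ρx)dx`, for `ρ ∈ (1,2]`, one has (96)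
`(Qk)(ρ) = ρ^{1/2}∫_{ρ⁻¹}^1 (D_uξ)(x)(D_uζ)(ρx)dx + ρ^{−1/2}(D_uξ)(ρ⁻¹)ζ(1) − ρ^{1/2}ξ(1)(D_uζ)(ρ)`."
**Proposition 5.3.** "For `ρ > 1` one has the equality (97) `Qε(ρ) = Σ_n λ(n)(1−λ(n)²)^{−1/2} T_n(ρ)`,
where (98) `T_n(ρ) = ρ^{1/2}∫_{ρ⁻¹}^1 (D_uξ_n)(x)(D_uζ_n)(ρx)dx + ρ^{−1/2}(D_uξ_n)(ρ⁻¹)ζ_n(1)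
− ρ^{1/2}ξ_n(1)(D_uζ_n)(ρ)`.  *Proof.* This follows from (84) [(sonine0), Thm. 4.7:
`ε(ρ) = Σ τ(n)⟨ξ_n|ϑ(ρ⁻¹)ζ_n⟩`, `τ(n) = λ(n)(1−λ(n)²)^{−1/2}`] combined with Lemma 5.2 and by
recalling the normalization (16) of the inner product in `L²(ℝ)_ev` [`⟨η|ξ⟩ = ∫_0^∞ η̄ξ`].  We refer to
Appendix F for the proof of the convergence of the infinite series and for an explicit control of the
remainder."  Then (p. 32): "by (74) [`𝒫₁η_n = λ(n)ξ_n`] one has `η_n = λ(n)ξ_n^{an}`, thus for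
`x ∈ [1,∞)`, `ζ_n(x) = λ(n)(1−λ(n)²)^{−1/2}ξ_n^{an}(x)`", whence `Qε(ρ) = Σ λ(n)²(1−λ(n)²)⁻¹ C_n` with
(99) `C_n = ρ^{1/2}∫_{ρ⁻¹}^1 x(ξ_n^{an})′(x) ρx(ξ_n^{an})′(ρx)dx + ρ^{−3/2}(ξ_n^{an})′(ρ⁻¹)ξ_n^{an}(1)
− ρ^{3/2}ξ_n^{an}(1)(ξ_n^{an})′(ρ)`.  "This formula shows, in particular, that the function `Qε(ρ)` is
`0` for `ρ = 1`."  **Lemma 5.4.** "The derivative of `ε(ρ)` at `ρ = 1⁺` is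
`ε′(1⁺) = Σ_n λ(n)²(1−λ(n)²)⁻¹ ξ_n(1)²`."  (Proof: `ε(ρ) = Σ λ(n)²(1−λ(n)²)⁻¹ ρ^{1/2}∫_{ρ⁻¹}^1
ξ_n^{an}(x)ξ_n^{an}(ρx)dx` and `ξ_n^{an}(1) = ξ_n(1)`.)  "The convergence of the series is ensured by
the inequality (see [Rokhlin], Theorem 12) (100) `|ξ_n(1)| ≤ (2n+½)^{1/2}`.  The numerical values of the
terms `t(n) = λ(n)²(1−λ(n)²)⁻¹ξ_n(1)²` are of the form `t(0) = 11.9719, t(1) = 8.77574, t(2) = 2.20528,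
t(3) = 0.0433983, t(4) = 0.000125459…` and the total value is of the order of `22.9965`.  As in (59)
[(Qprime)] we get, for the linear form (101) `E₊(f) := ∫ f(x)ε(exp|x|)dx`, `f ∈ C_c^∞(ℝ)`, the
expression (102) `E₊(Q₊f) = −2ε′(1₊)f(0) + ∫_0^∞ (f(x)+f(−x))(Qε)(exp x)dx`."  **Proposition 5.5**
(`N_I = −2ε′(1₊)(1 − 𝐊_I)`, `𝐊_I` compact of Hilbert–Schmidt class).  **Remark 5.6.** "The function
`Qε(ρ)` is `0` for `ρ = 1`.  This shows that the integral of diagonal values of the Schwartz kernel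
defining the compact operator `𝐊_I` is `0` independently of the size of `I`."

## How it is typed (tree vocabulary; cell rulings cc/ASSIGNMENTS §0 (B), §5 R1/R12; routes-1 (S1)/(S4))

* ADDITIVE AVATARS, as everywhere in this directory: `f ∈ C_c^∞(ℝ₊*)` is `F = f ∘ exp` with
  `IsWeilTest F`; `Q` is `opQ F = −F″ + F/4` (`VanishingIdealReduction.opQ`); `⟨η|ϑ(f)ξ⟩ =
  ∫ F(τ)⟨η|ϑ(e^τ)ξ⟩dτ = ∫ F τ * scalingCoeff η ξ τ` (`ArchimedeanSoninTrace.scalingCoeff`; this is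
  `⟪η, scalingOp F ξ⟫` by `ScalingOperator.inner_scalingOp` when `ξ ∈ L²`); CC's `½`-normalised inner
  product on even functions (eq. (16)) only changes both sides of (94) by the same factor.  The function
  `ε`, its terms and the density `ε ∘ exp` are seat t4's `ccEpsilon ψ ρ = epsDensity ψ (log ρ)`,
  `epsTerm`, `IsArchDensity` (`ArchimedeanTraceFormula.lean`), over an even prolate family
  `ψ : ℕ → ℝ → ℝ`, `IsProlateFunction 1 (2n) (ψ n)` (unique: `prolateFamily_unique`; it exists:
  `exists_prolateFamily`), with `λ(n) = prolateLambda (ψ n)`; CC's `ξ_n = √2·ψ n` (their `∫_0^∞ξ_n² = 1`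
  versus the tree's `∫_{−1}^1ψ² = 1`), `η_n = 𝔽ξ_n = √2·cosTransform (ψ n)` (seat t6's real cosine form
  of the Fourier transform of an even real function on `[−1,1]`, `SeriesRemainderBounds.lean`).  The
  `n`-th summand `τ(n)T_n(ρ)` of (97) in this normalisation is EXACTLY seat t6's
  `sonineQTerm (ψ n) (λ n) ρ` (`sonineQTerm_eq_cutCoeffQ` below), `D_u` on the cut-off side being
  `scaleDerivIn` (derivative within `[−1,1]`, one-sided at `1`, as Lemma 5.2 prescribes) and `scaleDeriv`
  on the smooth side.
* CC's `Q = −(ρ∂_ρ)² + ¼` ACTING ON A FUNCTION OF `ρ` (the `k(ρ)` of Lemmas 5.1/5.2, `ε` itself in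
  (97)) is `mulOpQ k ρ`; in the variable `ρ = e^y` it is the tree's `opQ` (`opQ_comp_exp`, PROVED:
  `(Qk)(e^y) = opQ (k ∘ exp) y`).  `𝒟 = D_u² + D_u` is `scaleOpD` ((92), for functions into any real
  normed space, so that it serves both the real vectors of §4 and the complex `L²(ℝ)`).
* NAMED FACTS (statements as printed, no proof claimed here; RH-FREE):
  `CC2021_lemma_5_1` (94) — with CC's "smooth functions in `L²(ℝ)_ev`" made precise by the square
  integrability of `ξ, D_uξ, 𝒟ξ` that both sides of (94) require — DISCHARGED at the end of the file
  (`CC2021_lemma_5_1_holds`, by the printed route: Fubini + integration by parts); `CC2021_lemma_5_2` (96) on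
  `ρ ∈ (1,2]` (with the twice-differentiability of `k` that "`(Qk)(ρ)`" presupposes) — DISCHARGED
  at the end of the file (`CC2021_lemma_5_2_holds`, from seat gm-t16's `C²` form of Lemma 5.2 in
  `ScalingCoeffBoundaryTerms.lean` by localisation);
  `CC2021_prop_5_3` (97)–(98) (`ε` is `C²` on `(1,∞)` and the series sums to `Qε(ρ)` for every `ρ > 1`);
  `CC2021_lemma_5_4` (slope at `1⁺`, with the summability the text asserts via (100); the printed VALUE
  `22.9965` and the five `t(n)` are NUMERICAL IN PRINT and are NOT minted as a fact — cell ruling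
  cc-lead 2026-08-26T03:07:27Z: the certified enclosure is the §6 engine's single numerical fact; here
  it only ever appears as a hypothesis; its input (100) = [Rokhlin–Xiao 2007, Thm. 12] is NOT typed as
  a fact — asserted in print without proof, see the section «The prolate input (100)» below);
  `CC2021_rem_5_6` (`Qε(1) = 0`, read on the `C²` branch: `opQ G 0 = 0` for every `C²` archimedean
  density `G`).  `CC2021_prop_5_3`, `CC2021_lemma_5_4`, `CC2021_rem_5_6` are derived FROM THE PROLATE DATUM
  (`∀ n, IsAppEProlateDatum n (ψ n) (lam n) (χ n)`, seat t6's `SeriesRemainderBounds.lean`) in seat gm-t16's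
  `ArchDensityRegularity.lean` (`CC2021_prop_5_3_of_datum`, `CC2021_lemma_5_4_of_datum`,
  `CC2021_rem_5_6_of_datum`; endpoint-input-free variants `…_of_core` in its companion
  `ArchDensityRegularityCore.lean`); what separates them from unconditional theorems is exactly the
  datum's remaining inputs — the §4 statements `CC2021_sec4_lambda_basic` (clause `|λ(n)| < 1`) and the
  eigenvalue decay (rapid-decay) (`CC2021_sec4_rapidDecay` = [Rokhlin–Xiao Thm. 14], itself resting on the
  unproved expansion (67): cell ruling R64 replaces it by Osipov's proved eventual decay bounds).
* PROVED here (RH-free calculus/bookkeeping): (92)-at-`0` and `𝒟 = D_u(D_u) + D_u`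
  (`scaleOpD_apply_zero`, `scaleOpD_eq_scaleDeriv`); (93) `∫𝒟f = 0` for `f ∈ C_c²`
  (`integral_scaleOpD_eq_zero`); the integration-by-parts identity of p. 30
  (`intervalIntegral_scaleDeriv_parts`); the dictionary `opQ_comp_exp`; `ε(1) = 0`
  (`epsTerm_zero`, `epsDensity_zero`, `ccEpsilon_one`, `IsArchDensity.apply_zero`); the summand
  dictionary `sonineQTerm_eq_cutCoeffQ` and (99) `sonineQTerm_eq_sonineQbis`; `T_n(1) = 0` from (74)
  (`sonineQTerm_one_eq_zero`, the termwise content of "`Qε(1) = 0`"); the transport of the slope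
  between `ρ = 1⁺` and `y = 0⁺` (`hasDerivWithinAt_ccEpsilon_iff`); **`ε` is REAL**: `𝔽` of an even
  real function on `[−1,1]` is the cosine transform (`fourier_ofReal_eq_cosTransform`,
  `prolateCutFourier_eq_ofReal`), whence `Im epsTerm = Im epsDensity = 0` and, for every `C²`
  archimedean density `G`, `Im G′(0) = 0` UNCONDITIONALLY (`im_deriv_eq_zero_of_isArchDensity` — the
  analytic half of the route binder K2); **the (H-ε)/K2 glue**: `deriv G 0 = ε′(1₊)`
  (`deriv_eq_tsum_epsSlopeTerm_of_lemma_5_4`), the binder shape `Im G′(0) = 0 ∧ 22.9 ≤ Re G′(0) ≤ 23.1`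
  from Lemma 5.4 + an enclosure of its series taken as a HYPOTHESIS (`densitySlope_of_lemma_5_4`), and
  (102) with `ε′(1₊)` named (`evenFunctional_opQ_archDensity`);
  Rem. 5.6 ⇒ the kernel `ϖ` of `𝐊_I` vanishes on the diagonal (`varpi_zero_of_rem_5_6`).
* CITED, not restated (typer lint rule): (101)/(102) = `JumpFormula.evenFunctional` /
  `evenFunctional_opQ` (generic `C²` branch `G`); Prop. 5.5 = `JumpFormula.opN`, `varpi`,
  `evenFunctional_opQ_autocorr_eq_inner_opN` (quadratic form (103) and `N_I = −2G′(0)(1 − windowOp ϖ_G)`),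
  `KernelApproximation.windowOp` (`𝐊_I` of (104)), `WindowOperatorCompact.isCompactOperator_windowOp_varpi`
  (`𝐊_I` compact); Thm. 4.7 / (sonine0) = `CC2021_thm_4_7`, `ccEpsilon_of_one_le`; App. F =
  `CC2021_lemma_49_i/_ii` (convergence and remainder of (97) on `[1,2]`).

## ERRATUM located while typing (reported to the cell referee; it does not affect Lemma 5.4)

(100) `|ξ_n(1)| ≤ (2n+½)^{1/2}` mis-transfers [Rokhlin–Xiao 2007, Thm. 12] ("for any `c > 0` and integer
`m ≥ 0`, `ψ_m^c(1) < (m+½)^{1/2}`" for `‖ψ_m^c‖_{L²[−1,1]} = 1`, Table 2 loc. cit.): CC's `ξ_n` has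
`∫_{−1}^1ξ_n² = 2`, so the correct transfer is `|ξ_n(1)| < (4n+1)^{1/2}`; the paper's own `t(3), λ(3)` give
`|ξ_3(1)| ≈ 3.53 > 6.5^{1/2}` (seat t6, `SeriesRemainderBounds.lean` ERRATA 1).  The SOURCE's inequality
itself is asserted without printed proof and is not typed as a fact (section «The prolate input (100)»
below); either form of the bound — or none, via the endpoint-free control of seat gm-t16 — makes the series
of Lemma 5.4 converge ((rapid-decay) of `λ(n)`).

## Deliberately NOT here

No definition of `λ(n)` as an eigenvalue, of `𝒫₁, 𝒫̂₁`, `ξ_n, η_n` as `L²` vectors (seat t3, §4), no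
second copy of `ε`/`E₊`/`N_I`/`𝐊_I` (t4, `JumpFormula`), no convergence estimate (t6, App. F), no
numerics beyond the printed digits, no `instance`/`notation`.  Discharge order (cell ASSIGNMENTS §3
D5): Lemma 5.2 (generic calculus) → Prop. 5.3 termwise → Lemma 5.4 / Rem. 5.6 → K0 `DensityRegular`
with seat gm-t16's E1–E3; the VALUE `22.9965` is certified-numerics work (cell engine), never here.
-/

noncomputable section

open MeasureTheory Set Filter intervalIntegral
open scoped Real Topology ComplexConjugate

namespace Literature.NumberTheory.ConnesConsani2021

open Literature.NumberTheory.LFunctions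

/-! ## The scaling Hamiltonian `D_u` and `𝒟 = D_u² + D_u` (eq. (92)) -/

section ScaleOp

variable {E : Type*} [NormedAddCommGroup E] [NormedSpace ℝ E]

/-- RH-FREE. CC's operator `𝒟 := D_u² + D_u`, `D_u(f)(x) = x f′(x)`, in the printed closed form (92)
`𝒟(f)(x) = x²f″(x) + 2xf′(x)` (§5 p. 29), for a function of a real variable with values in a real normed
space (`E = ℝ` for the real prolate vectors of §4, `E = ℂ` for `L²(ℝ)`).  For a twice differentiable
real `f` it is `D_u(D_uf) + D_uf` with seat t6's `scaleDeriv` (`scaleOpD_eq_scaleDeriv`).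
[cite: ConnesConsani2021, §5 eq. (92) p. 29 (arXiv chunk p0019:L9–L16)] -/
def scaleOpD (f : ℝ → E) (x : ℝ) : E :=
  (x ^ 2) • deriv (deriv f) x + (2 * x) • deriv f x

/-- RH-FREE. Unfolding `scaleOpD`. [cite: ConnesConsani2021, §5 eq. (92) p. 29] -/
theorem scaleOpD_apply (f : ℝ → E) (x : ℝ) :
    scaleOpD f x = (x ^ 2) • deriv (deriv f) x + (2 * x) • deriv f x := rfl

/-- RH-FREE. "thus `𝒟(f)(0) = 0`" (p. 29, after (92)). [cite: ConnesConsani2021, §5 p. 29 (arXiv chunk p0019:L17)] -/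
@[simp] theorem scaleOpD_apply_zero (f : ℝ → E) : scaleOpD f 0 = 0 := by
  simp [scaleOpD]

/-- RH-FREE. `𝒟 = D_u ∘ D_u + D_u` on real functions: `x·(x f′)′ + x f′ = x²f″ + 2xf′` wherever `f′` is
differentiable (product rule). [cite: ConnesConsani2021, §5 eq. (92) p. 29 (arXiv chunk p0019:L9–L16)] -/
theorem scaleOpD_eq_scaleDeriv {f : ℝ → ℝ} {x : ℝ} (hf : DifferentiableAt ℝ (deriv f) x) :
    scaleOpD f x = scaleDeriv (scaleDeriv f) x + scaleDeriv f x := by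
  have hfun : scaleDeriv f = fun y : ℝ => y * deriv f y := rfl
  have h : deriv (fun y : ℝ => y * deriv f y) x = 1 * deriv f x + x * deriv (deriv f) x :=
    ((hasDerivAt_id x).mul hf.hasDerivAt).deriv
  rw [scaleOpD, scaleDeriv, hfun, h, smul_eq_mul, smul_eq_mul]
  ring

/-- RH-FREE. **(93), the second vanishing condition**: for `f ∈ C²(ℝ)` of compact support,
`∫_ℝ 𝒟f = 0` ("`f̂(0) = 0`" for `f` in the range of `𝒟`), since `𝒟f = (x²f′)′`.  Printed for `𝒮(ℝ)`;
proved here for `C_c²`, which is what the test functions are.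
[cite: ConnesConsani2021, §5 eq. (93) p. 29 (arXiv chunk p0019:L17–L20)] -/
theorem integral_scaleOpD_eq_zero [CompleteSpace E] {f : ℝ → E} (hf : ContDiff ℝ 2 f)
    (hfs : HasCompactSupport f) : ∫ x, scaleOpD f x = 0 := by
  have hf1 : ContDiff ℝ 1 (deriv f) := by
    rw [← one_add_one_eq_two] at hf
    exact hf.deriv'
  have hdf : Differentiable ℝ (deriv f) := hf1.differentiable one_ne_zero
  have hcf'' : Continuous (deriv (deriv f)) := hf1.continuous_deriv le_rfl
  have hcf' : Continuous (deriv f) := hf1.continuous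
  -- `F(x) = x² f′(x)` has derivative `𝒟f`
  have hF : ∀ x, HasDerivAt (fun y : ℝ => (y ^ 2) • deriv f y) (scaleOpD f x) x := fun x => by
    have h1 : HasDerivAt (fun y : ℝ => y ^ 2) (2 * x) x := by
      simpa using (hasDerivAt_pow 2 x)
    have h2 : HasDerivAt (deriv f) (deriv (deriv f) x) x := (hdf x).hasDerivAt
    have := h1.smul h2
    -- `this : HasDerivAt (fun y => y^2 • deriv f y) ((2*x) • deriv f x + x^2 • deriv (deriv f) x) x`
    refine this.congr_deriv ?_
    rw [scaleOpD, add_comm]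
  have hFs : HasCompactSupport fun y : ℝ => (y ^ 2) • deriv f y := hfs.deriv.smul_left
  have hFi : Integrable fun y : ℝ => (y ^ 2) • deriv f y :=
    ((continuous_id.pow 2).smul hcf').integrable_of_hasCompactSupport hFs
  have hDs : HasCompactSupport (scaleOpD f) := by
    refine HasCompactSupport.add ?_ ?_
    · exact hfs.deriv.deriv.smul_left
    · exact hfs.deriv.smul_left
  have hDc : Continuous (scaleOpD f) :=
    ((continuous_id.pow 2).smul hcf'').add ((continuous_const.mul continuous_id).smul hcf')
  exact integral_eq_zero_of_hasDerivAt_of_integrable hF (hDc.integrable_of_hasCompactSupport hDs) hFi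

/-- RH-FREE. **The integration by parts of p. 30** ("which gives the adjoint of `D_u` as `−1 − D_u`"):
`∫_a^b D_u(f)(x)g(x)dx + ∫_a^b f(x)((1+D_u)g)(x)dx = b f(b)g(b) − a f(a)g(a)`, "as can be seen by
differentiating the product `(x f(x)g(x))′ = x f′(x)g(x) + f(x)(g(x) + x g′(x))`"; for real `f, g`
differentiable on `[a,b]` with continuous derivatives `f′, g′`.
[cite: ConnesConsani2021, §5 p. 30 (proof of Lemma 5.2; arXiv chunk p0020:L40–L44)] -/
theorem intervalIntegral_scaleDeriv_parts {f g f' g' : ℝ → ℝ} {a b : ℝ}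
    (hf : ∀ x ∈ uIcc a b, HasDerivAt f (f' x) x) (hg : ∀ x ∈ uIcc a b, HasDerivAt g (g' x) x)
    (hf' : ContinuousOn f' (uIcc a b)) (hg' : ContinuousOn g' (uIcc a b)) :
    (∫ x in a..b, x * f' x * g x) + ∫ x in a..b, f x * (g x + x * g' x)
      = b * f b * g b - a * f a * g a := by
  have hfc : ContinuousOn f (uIcc a b) := fun x hx => (hf x hx).continuousAt.continuousWithinAt
  have hgc : ContinuousOn g (uIcc a b) := fun x hx => (hg x hx).continuousAt.continuousWithinAt
  have hderiv : ∀ x ∈ uIcc a b,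
      HasDerivAt (fun y => y * f y * g y) (x * f' x * g x + f x * (g x + x * g' x)) x := by
    intro x hx
    have h := ((hasDerivAt_id x).mul (hf x hx)).mul (hg x hx)
    refine h.congr_deriv ?_
    simp only [Pi.mul_apply, id_eq]
    ring
  have hi1 : IntervalIntegrable (fun x => x * f' x * g x) volume a b :=
    ((continuousOn_id.mul hf').mul hgc).intervalIntegrable
  have hi2 : IntervalIntegrable (fun x => f x * (g x + x * g' x)) volume a b :=
    (hfc.mul (hgc.add (continuousOn_id.mul hg'))).intervalIntegrable
  rw [← integral_add hi1 hi2, integral_eq_sub_of_hasDerivAt hderiv (hi1.add hi2)]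

end ScaleOp

/-! ## CC's `Q = −(ρ∂_ρ)² + ¼` on functions of `ρ`, and its additive form `opQ` -/

section MulQ

variable {E : Type*} [NormedAddCommGroup E] [NormedSpace ℝ E]

/-- RH-FREE. CC's differential operator `Q = −(ρ∂_ρ)² + ¼` (eq. (55), printed Lemma 3.3 (iii); on test
functions it is `VanishingIdealReduction.opQ` in the additive variable) APPLIED TO A FUNCTION OF
`ρ ∈ ℝ₊*` — the `(Qk)(ρ)` of Lemmas 5.1/5.2 and the
`Qε(ρ)` of Prop. 5.3: `(Qk)(ρ) = −ρ (ρ k′)′(ρ) + k(ρ)/4`.  Values in a real normed space (`ℝ` for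
Lemma 5.2, `ℂ` for `ε = ccEpsilon ψ`).  In the variable `ρ = e^y` this is the tree's additive
`opQ (k ∘ exp) y = −(k∘exp)″(y) + (k∘exp)(y)/4` (`opQ_comp_exp`).
[cite: ConnesConsani2021, Lemma 3.3 eq. (55) §3 p. 18; §5 Lemma 5.2 eq. (96) p. 30 (arXiv chunk p0019:L77–L80)] -/
def mulOpQ (k : ℝ → E) (ρ : ℝ) : E :=
  -(ρ • deriv (fun r : ℝ => r • deriv k r) ρ) + (1 / 4 : ℝ) • k ρ

/-- RH-FREE. Unfolding `mulOpQ`. [cite: ConnesConsani2021, §5 Lemma 5.2 eq. (96) p. 30] -/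
theorem mulOpQ_apply (k : ℝ → E) (ρ : ℝ) :
    mulOpQ k ρ = -(ρ • deriv (fun r : ℝ => r • deriv k r) ρ) + (1 / 4 : ℝ) • k ρ := rfl

/-- RH-FREE. **Dictionary `(ρ∂_ρ) ↔ ∂_y` at `ρ = e^y`**: if `k : ℝ → ℂ` is differentiable near `e^y` and
`r ↦ r k′(r)` is differentiable at `e^y`, then `(Qk)(e^y) = opQ (k ∘ exp) y`, i.e.
`−(k∘exp)″(y) + k(e^y)/4 = −e^y (r k′)′(e^y) + k(e^y)/4` (chain rule twice: `(k∘exp)′ = (r k′) ∘ exp`).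
This is how "`Q` becomes `Q₊ = −∂_x² + ¼`" (proof of Thm. 3.6, p. 19) for the densities of §5.
[cite: ConnesConsani2021, Thm. 3.6 proof §3 p. 19 (arXiv chunk p0013:L40–L43); §5 Prop. 5.3 p. 32] -/
theorem opQ_comp_exp {k : ℝ → ℂ} {y : ℝ} (h1 : ∀ᶠ r in 𝓝 (Real.exp y), DifferentiableAt ℝ k r)
    (h2 : DifferentiableAt ℝ (fun r : ℝ => r • deriv k r) (Real.exp y)) :
    opQ (fun t => k (Real.exp t)) y = mulOpQ k (Real.exp y) := by
  -- first derivative on a neighbourhood of `y`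
  have hnhds : ∀ᶠ t in 𝓝 y, DifferentiableAt ℝ k (Real.exp t) :=
    (Real.continuous_exp.continuousAt (x := y)).eventually h1
  have hD1 : ∀ᶠ t in 𝓝 y,
      HasDerivAt (fun t => k (Real.exp t)) (Real.exp t • deriv k (Real.exp t)) t := by
    filter_upwards [hnhds] with t ht
    exact ht.hasDerivAt.scomp t (Real.hasDerivAt_exp t)
  have hderiv : deriv (fun t => k (Real.exp t)) =ᶠ[𝓝 y]
      fun t => (fun r : ℝ => r • deriv k r) (Real.exp t) := by
    filter_upwards [hD1] with t ht
    exact ht.deriv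
  have hD2 : HasDerivAt (fun t => (fun r : ℝ => r • deriv k r) (Real.exp t))
      (Real.exp y • deriv (fun r : ℝ => r • deriv k r) (Real.exp y)) y :=
    h2.hasDerivAt.scomp y (Real.hasDerivAt_exp y)
  have hdd : deriv (deriv fun t => k (Real.exp t)) y
      = Real.exp y • deriv (fun r : ℝ => r • deriv k r) (Real.exp y) := by
    rw [hderiv.deriv_eq]
    exact hD2.deriv
  rw [opQ_apply, hdd, mulOpQ]
  simp only [Complex.real_smul]
  push_cast
  ring

/-- RH-FREE. `(Qk)(ρ)` depends only on the germ of `k` at `ρ` (both derivatives in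
`Q = −(ρ∂_ρ)² + ¼` are local) — the localisation used when `Q` is applied to a coefficient `k(ρ)` given
by different formulas on different ranges (Lemma 5.2: `ρ ∈ (1,2]`).
[cite: ConnesConsani2021, Lemma 3.3 eq. (55) §3 p. 18; §5 Lemma 5.2 eq. (96) p. 30 (arXiv chunk p0019:L77–L80)] -/
theorem mulOpQ_congr_of_eventuallyEq {k₁ k₂ : ℝ → E} {ρ : ℝ} (h : k₁ =ᶠ[𝓝 ρ] k₂) :
    mulOpQ k₁ ρ = mulOpQ k₂ ρ := by
  have h1 : (fun r : ℝ => r • deriv k₁ r) =ᶠ[𝓝 ρ] fun r : ℝ => r • deriv k₂ r := by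
    filter_upwards [h.deriv] with r hr
    rw [hr]
  rw [mulOpQ, mulOpQ, h1.deriv_eq, h.eq_of_nhds]

/-- RH-FREE. **Real-valued coefficients**: for `k : ℝ → ℝ` differentiable near `ρ` with `r ↦ r k′(r)`
differentiable at `ρ`, `Q` of the complexified function is the complexification of `Qk` — how the real
Lemma 5.2 (`cutCoeff`, `cutCoeffQ`) is read inside the complex-valued `ε` of Prop. 5.3 (eq. (97): `Qε(ρ)`
with `ε` the series (sonine0) of real terms).
[cite: ConnesConsani2021, §5 Lemma 5.2 eq. (96) p. 30; Prop. 5.3 eq. (97) p. 32 (arXiv items 29–30, chunk p0019:L77–p0020:L64)] -/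
theorem mulOpQ_ofReal {k : ℝ → ℝ} {ρ : ℝ} (h1 : ∀ᶠ r in 𝓝 ρ, DifferentiableAt ℝ k r)
    (h2 : DifferentiableAt ℝ (fun r : ℝ => r • deriv k r) ρ) :
    mulOpQ (fun r => ((k r : ℝ) : ℂ)) ρ = ((mulOpQ k ρ : ℝ) : ℂ) := by
  have hd1 : deriv (fun r => ((k r : ℝ) : ℂ)) =ᶠ[𝓝 ρ] fun r => ((deriv k r : ℝ) : ℂ) := by
    filter_upwards [h1] with r hr
    exact hr.hasDerivAt.ofReal_comp.deriv
  have hd2 : (fun r : ℝ => r • deriv (fun r => ((k r : ℝ) : ℂ)) r) =ᶠ[𝓝 ρ]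
      fun r => (((r • deriv k r : ℝ)) : ℂ) := by
    filter_upwards [hd1] with r hr
    rw [hr, smul_eq_mul, Complex.ofReal_mul, Complex.real_smul]
  have hd3 : deriv (fun r : ℝ => r • deriv (fun r => ((k r : ℝ) : ℂ)) r) ρ
      = ((deriv (fun r : ℝ => r • deriv k r) ρ : ℝ) : ℂ) := by
    rw [hd2.deriv_eq]
    exact h2.hasDerivAt.ofReal_comp.deriv
  rw [mulOpQ, mulOpQ, hd3]
  simp only [Complex.real_smul, smul_eq_mul]
  push_cast
  ring

end MulQ

/-! ## Lemma 5.1 (eq. (94)) -/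

/-- RH-FREE. **Connes–Consani 2021, Lemma 5.1 (= arXiv item Lemma 28), eq. (94) — NAMED FACT (statement
as printed), DISCHARGED below (`CC2021_lemma_5_1_holds`).**  "Let `ξ, η ∈ L²(ℝ)_ev` be smooth functions.  Then with
`Q = −(ρ∂_ρ)² + ¼` and `𝒟 := D_u² + D_u`, one has `⟨η|ϑ(Qf)ξ⟩ = −⟨η|ϑ(f)𝒟ξ⟩` for all
`f ∈ C_c^∞(ℝ₊*)`."  Typed with the additive avatar `F = f ∘ exp` (`IsWeilTest F`, `Qf ↦ opQ F`) and
`⟨η|ϑ(f)ξ⟩ = ∫ F(τ)⟨η|ϑ(e^τ)ξ⟩dτ = ∫ F τ · scalingCoeff η ξ τ` (both sides in Mathlib's inner product;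
CC's factor `½` of eq. (16) is common to both sides).  CC's "smooth functions in `L²(ℝ)_ev`": `ξ, η`
smooth and even, `ξ, η ∈ L²`, and — implicit in print, since the right-hand side must make sense —
`D_uξ, 𝒟ξ ∈ L²`.  The printed proof computes `Q(ρ^{1/2}ξ(ρx)) = −ρ^{1/2}(𝒟ξ)(ρx)` and integrates by
parts in `ρ`; discharged below by exactly that route (Fubini + integration by parts in `τ = −log ρ`,
`CC2021_lemma_5_1_holds`).
[cite: ConnesConsani2021, Lemma 5.1 eq. (94) §5 p. 29 (arXiv item Lemma 28, chunk p0019:L23–L26; proof L28–L68)] -/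
def CC2021_lemma_5_1 : Prop :=
  ∀ ξ η : ℝ → ℂ, ContDiff ℝ (⊤ : ℕ∞) ξ → ContDiff ℝ (⊤ : ℕ∞) η →
    (∀ x, ξ (-x) = ξ x) → (∀ x, η (-x) = η x) →
    MemLp ξ 2 volume → MemLp η 2 volume →
    MemLp (fun x : ℝ => (x : ℂ) * deriv ξ x) 2 volume → MemLp (scaleOpD ξ) 2 volume →
      ∀ F : ℝ → ℂ, IsWeilTest F →
        ∫ τ, opQ F τ * scalingCoeff η ξ τ = -∫ τ, F τ * scalingCoeff η (scaleOpD ξ) τ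

/-! ## Lemma 5.2 (eq. (96)): `Qk` for the cut-off pair, with its boundary terms -/

/-- RH-FREE. **The coefficient `k(ρ)` of Lemma 5.2**: `k(ρ) = ρ^{1/2}∫_0^∞ ξ(x)ζ(ρx)dx` for `ξ` cut off to
`x ≤ 1` and `ζ` to `x ≥ 1`, i.e. ("since `ξ(x)ζ(ρx) = 0` for `x ∉ [ρ⁻¹,1]`", first line of the proof)
`k(ρ) = ρ^{1/2}∫_{ρ⁻¹}^1 ξ(x)ζ(ρx)dx` — the matrix coefficient `⟨ζ|ϑ(ρ⁻¹)ξ⟩` in CC's inner product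
`∫_0^∞` on even functions.  For `ξ = ψ_n`, `ζ = cosTransform ψ_n` (tree units) the `n`-th term of `ε` is
`2λ(n)(1−λ(n)²)⁻¹ k(ρ)` (`epsTerm`, seat t4; the `2` is `∫_{−1}^1ξ_n²`).
[cite: ConnesConsani2021, Lemma 5.2 §5 p. 29 (arXiv item Lemma 29, chunk p0019:L77; proof L82)] -/
def cutCoeff (ξ ζ : ℝ → ℝ) (ρ : ℝ) : ℝ :=
  Real.sqrt ρ * ∫ x in ρ⁻¹..1, ξ x * ζ (ρ * x)

/-- RH-FREE. **The right-hand side of (96)**: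
`ρ^{1/2}∫_{ρ⁻¹}^1 (D_uξ)(x)(D_uζ)(ρx)dx + ρ^{−1/2}(D_uξ)(ρ⁻¹)ζ(1) − ρ^{1/2}ξ(1)(D_uζ)(ρ)`, with `D_u` on
the `ξ`-side the derivative within `[−1,1]` (one-sided at `1`: `ξ ∈ C^∞((0,1])` is cut off above `1`;
seat t6's `scaleDerivIn`) and on the `ζ`-side the ordinary one (`scaleDeriv`; `ζ` is only evaluated at
points `≥ 1`, the lower endpoint `ρx = 1` of the integral being immaterial).  The bracket of seat t6's
`sonineQTerm` is literally `cutCoeffQ ψ (cosTransform ψ)` (`sonineQTerm_eq_cutCoeffQ`).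
[cite: ConnesConsani2021, Lemma 5.2 eq. (96) §5 p. 30 (arXiv item Lemma 29, chunk p0019:L78–L80)] -/
def cutCoeffQ (ξ ζ : ℝ → ℝ) (ρ : ℝ) : ℝ :=
  Real.sqrt ρ * (∫ x in ρ⁻¹..1, scaleDerivIn ξ x * scaleDeriv ζ (ρ * x))
    + (Real.sqrt ρ)⁻¹ * scaleDerivIn ξ ρ⁻¹ * ζ 1 - Real.sqrt ρ * ξ 1 * scaleDeriv ζ ρ

/-- RH-FREE. **Connes–Consani 2021, Lemma 5.2 (= arXiv item Lemma 29), eq. (96) — NAMED FACT (statement as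
printed), DISCHARGED below (`CC2021_lemma_5_2_holds`).**  "Let `ξ ∈ C^∞((0,1])` and `ζ ∈ C^∞([1,∞))` be smooth and real valued
functions.  Extend first `ξ, ζ` to `[0,∞)` as follows: `ξ(x) := 0` for `x > 1` and `ζ(x) := 0` for
`x < 1`.  Then, with `Q = −(ρ∂_ρ)² + ¼` and `k(ρ) = ρ^{1/2}∫_0^∞ ξ(x)ζ(ρx)dx`, for `ρ ∈ (1,2]`, one has
`(Qk)(ρ) = ρ^{1/2}∫_{ρ⁻¹}^1 (D_uξ)(x)(D_uζ)(ρx)dx + ρ^{−1/2}(D_uξ)(ρ⁻¹)ζ(1) − ρ^{1/2}ξ(1)(D_uζ)(ρ)`."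
Typed with `k = cutCoeff ξ ζ` (the cut-offs built in), `Qk = mulOpQ k`, the right side `cutCoeffQ`; the
twice-differentiability of `k` at `ρ` that "`(Qk)(ρ)`" presupposes is made an explicit conjunct.  The
values of `ξ` off `(0,1]` and of `ζ` off `[1,∞)` never enter.  Dischargeable RH-free calculus
(differentiation of a parametric integral with moving endpoint + the integration by parts
`intervalIntegral_scaleDeriv_parts`); the cell's per-term regularity lemmas (seat gm-t16, E3) are its
first half.
[cite: ConnesConsani2021, Lemma 5.2 eq. (96) §5 pp. 29–30 (arXiv item Lemma 29, chunk p0019:L77–L80; proof p0019:L82–p0020:L55)] -/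
def CC2021_lemma_5_2 : Prop :=
  ∀ ξ ζ : ℝ → ℝ, ContDiffOn ℝ (⊤ : ℕ∞) ξ (Ioc 0 1) → ContDiffOn ℝ (⊤ : ℕ∞) ζ (Ici 1) →
    ∀ ρ ∈ Ioc (1 : ℝ) 2,
      DifferentiableAt ℝ (cutCoeff ξ ζ) ρ ∧
        DifferentiableAt ℝ (fun r : ℝ => r • deriv (cutCoeff ξ ζ) r) ρ ∧
          mulOpQ (cutCoeff ξ ζ) ρ = cutCoeffQ ξ ζ ρ

/-! ## The even prolate family exists (so that the facts below are not vacuous) -/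

/-- RH-FREE. There IS an even prolate family `ψ` (`IsProlateFunction 1 (2n) (ψ n)` for all `n`): existence
half of the tree theorem `existsUnique_isProlateFunction_holds`; with `prolateFamily_unique` the
universally quantified prolate family of the facts below is exactly one object (CC's `φ_n`, normalised).
[cite: ConnesConsani2021, §4 eq. (prolateeq) p. 24 (arXiv chunk p0016:L17–L23)] -/
theorem exists_prolateFamily : ∃ ψ : ℕ → ℝ → ℝ, ∀ n, IsProlateFunction 1 (2 * n) (ψ n) :=
  ⟨fun n => Classical.choose
      (existsUnique_isProlateFunction_holds 1 one_pos (2 * n) (even_two_mul n)).exists,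
    fun n => Classical.choose_spec
      (existsUnique_isProlateFunction_holds 1 one_pos (2 * n) (even_two_mul n)).exists⟩

/-! ## `ε(1) = 0` (disjoint supports of `ξ_n` and `ζ_n`) -/

/-- RH-FREE. Each term of (sonine0) vanishes at `ρ = 1` (`y = 0`): `⟨ξ_n|ζ_n⟩ = 0` because `ξ_n` lives on
`[−1,1]` and `ζ_n = Pη_n/‖Pη_n‖` on `|x| ≥ 1` (Prop. 4.5 (iii): "the vectors `ξ_n` are all orthogonal to
… `ζ_n`"; the overlap `{±1}` is Lebesgue-null).  Needs only that `φ` vanishes off `[−1,1]`.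
[cite: ConnesConsani2021, Prop. 4.5 (iii) §4 pp. 25–26 (arXiv item Prop. 25, chunk p0017:L61–L63); Thm. 4.7 eq. (84) p. 27] -/
theorem epsTerm_zero {φ : ℝ → ℝ} (hφ : ∀ x : ℝ, 1 < |x| → φ x = 0) : epsTerm φ 0 = 0 := by
  have hint : scalingCoeff (fun v => (φ v : ℂ)) (prolateCutFourier φ) 0 = 0 := by
    rw [scalingCoeff]
    refine integral_eq_zero_of_ae ?_
    filter_upwards [Measure.ae_ne volume (1 : ℝ), Measure.ae_ne volume (-1 : ℝ)] with v h1 h2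
    rcases lt_or_gt_of_ne (show |v| ≠ 1 from fun h => by
      rcases abs_eq (zero_le_one) |>.1 h with h' | h'
      · exact h1 h'
      · exact h2 h') with hv | hv
    · simp [prolateCutFourier_eq_zero_of_abs_lt_one φ (by simpa using hv)]
    · simp [hφ v hv]
  simp [epsTerm, hint]

/-- RH-FREE. `ε(e^0) = Σ_n 0 = 0` for a prolate family (each `ψ n` vanishes off `[−1,1]`).
[cite: ConnesConsani2021, Thm. 4.7 eq. (84) §4 p. 27 (arXiv chunk p0018:L37–L40)] -/
theorem epsDensity_zero {ψ : ℕ → ℝ → ℝ} (hψ : ∀ n, IsProlateFunction 1 (2 * n) (ψ n)) :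
    epsDensity ψ 0 = 0 := by
  simp only [epsDensity, abs_zero, epsTerm_zero (fun x hx => (hψ _).support x hx), tsum_zero]

/-- RH-FREE. `ε(1) = 0`. [cite: ConnesConsani2021, Thm. 4.7 eq. (84) §4 p. 27 (arXiv chunk p0018:L37–L40)] -/
theorem ccEpsilon_one {ψ : ℕ → ℝ → ℝ} (hψ : ∀ n, IsProlateFunction 1 (2 * n) (ψ n)) :
    ccEpsilon ψ 1 = 0 := by
  simp only [ccEpsilon, Real.log_one, epsDensity_zero hψ]

/-- RH-FREE. An archimedean density vanishes at `0`: `G(0) = ε(1) = 0`.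
[cite: ConnesConsani2021, Thm. 4.7 eq. (84) §4 p. 27; §5 eq. (101) p. 33] -/
theorem IsArchDensity.apply_zero {G : ℝ → ℂ} (hG : IsArchDensity G) : G 0 = 0 := by
  obtain ⟨ψ, hψ⟩ := exists_prolateFamily
  rw [hG ψ hψ 0 le_rfl, epsDensity_zero hψ]

/-! ## Proposition 5.3 (eqs. (97)–(99)): the series for `Qε` -/

/-- RH-FREE. **The summand of (97) in tree units is seat t6's `sonineQTerm`**:
`τ(n)T_n(ρ) = 2λ(1−λ²)⁻¹ · [ρ^{1/2}∫_{ρ⁻¹}^1 D_uψ·D_uη̃(ρ·) + ρ^{−1/2}D_uψ(ρ⁻¹)η̃(1) − ρ^{1/2}ψ(1)D_uη̃(ρ)]`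
`= 2λ(1−λ²)⁻¹ · cutCoeffQ ψ (cosTransform ψ) ρ` (`ξ_n = √2ψ`, `ζ_n = √2η̃/√(1−λ²)`, `η̃ = cosTransform ψ`,
`τ(n) = λ/√(1−λ²)`).  By definition. [cite: ConnesConsani2021, Prop. 5.3 eq. (98) §5 p. 32 (arXiv item Prop. 30, chunk p0020:L59–L64)] -/
theorem sonineQTerm_eq_cutCoeffQ (ψ : ℝ → ℝ) (lam ρ : ℝ) :
    sonineQTerm ψ lam ρ = 2 * lam / (1 - lam ^ 2) * cutCoeffQ ψ (cosTransform ψ) ρ := rfl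

/-- RH-FREE. **Connes–Consani 2021, Proposition 5.3 (= arXiv item Prop. 30), eqs. (97)–(98) — NAMED FACT
(statement as printed; no proof claimed here).**  "For `ρ > 1` one has the equality
`Qε(ρ) = Σ_n λ(n)(1−λ(n)²)^{−1/2} T_n(ρ)`, where
`T_n(ρ) = ρ^{1/2}∫_{ρ⁻¹}^1 (D_uξ_n)(x)(D_uζ_n)(ρx)dx + ρ^{−1/2}(D_uξ_n)(ρ⁻¹)ζ_n(1) − ρ^{1/2}ξ_n(1)(D_uζ_n)(ρ)`."
Typed over THE even prolate family (`ψ`, `λ(n) = prolateLambda (ψ n)`; seat t4): (i) `ε = ccEpsilon ψ`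
is `C²` on `(1, ∞)` (what "`Qε(ρ)`, `ρ > 1`" presupposes), and (ii) for every `ρ > 1` the series of the
tree-unit summands `sonineQTerm (ψ n) (λ n) ρ = τ(n)T_n(ρ)` (`sonineQTerm_eq_cutCoeffQ`) converges to
`(Qε)(ρ) = mulOpQ (ccEpsilon ψ) ρ` (complex-valued as typed; real in print).  Printed proof: (sonine0)
(`ccEpsilon_of_one_le`) + Lemma 5.2 termwise + normalisation (16); convergence and remainder on
`ρ ∈ [1,2]` = App. F Lemma F.1 (seat t6: `CC2021_lemma_49_i`), which uses (74) `𝒫₁η_n = λ(n)ξ_n`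
(Slepian; seat t3's `CC2021_sec4_cosalphan`) and (rapid-decay).  In the variable `ρ = e^y`, (ii) reads
`opQ (epsDensity ψ) y = Σ'…` for `y > 0` (`opQ_comp_exp`).
[cite: ConnesConsani2021, Prop. 5.3 eqs. (97)–(98) §5 p. 32 (arXiv item Prop. 30, chunk p0020:L59–L67)] -/
def CC2021_prop_5_3 : Prop :=
  ∀ ψ : ℕ → ℝ → ℝ, (∀ n, IsProlateFunction 1 (2 * n) (ψ n)) →
    ContDiffOn ℝ 2 (ccEpsilon ψ) (Ioi 1) ∧
      ∀ ρ : ℝ, 1 < ρ →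
        HasSum (fun n : ℕ => ((sonineQTerm (ψ n) (prolateLambda (ψ n)) ρ : ℝ) : ℂ))
          (mulOpQ (ccEpsilon ψ) ρ)

/-- RH-FREE. **Eq. (99)**: with the "analytic continuation" `ξ^{an}` — in tree units the function that is
`ψ` on `[−1,1]` and `η̃/λ` on `[1,∞)` (`η̃ = cosTransform ψ`; by (74) `η_n = λ(n)ξ_n^{an}`,
`ζ_n = τ(n)·ξ_n^{an}` on `[1,∞)`) — and `D_u f = x f′`, the summand is
`τ(n)T_n(ρ) = 2λ²(1−λ²)⁻¹·C_n`, `C_n = ρ^{1/2}∫_{ρ⁻¹}^1 x(ξ^{an})′(x)·ρx(ξ^{an})′(ρx)dx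
+ ρ^{−3/2}(ξ^{an})′(ρ⁻¹)ξ^{an}(1) − ρ^{3/2}ξ^{an}(1)(ξ^{an})′(ρ)` ("convenient … in a computer program").
PROVED (algebra), for `λ ≠ 0` and `ρ > 0`, from (74) at the point `x = 1` only (`η̃(1) = λψ(1)`,
i.e. "`ξ_n^{an}(1) = ξ_n(1)`"); here `ξan := cosTransform ψ / λ` on the `ζ`-side, `ρ^{±3/2}` as real
powers.
[cite: ConnesConsani2021, Prop. 5.3 eq. (99) §5 p. 32 (arXiv chunk p0020:L69–L83)] -/
theorem sonineQTerm_eq_sonineQbis {ψ : ℝ → ℝ} {lam ρ : ℝ} (hlam : lam ≠ 0) (hρ : 0 < ρ)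
    (h1 : cosTransform ψ 1 = lam * ψ 1) :
    sonineQTerm ψ lam ρ = 2 * lam ^ 2 / (1 - lam ^ 2) *
      (Real.sqrt ρ * (∫ x in ρ⁻¹..1, x * derivWithin ψ (Icc (-1) 1) x
          * ((ρ * x) * deriv (fun y => cosTransform ψ y / lam) (ρ * x)))
        + ρ ^ (-(3 : ℝ) / 2) * derivWithin ψ (Icc (-1) 1) ρ⁻¹ * (cosTransform ψ 1 / lam)
        - ρ ^ ((3 : ℝ) / 2) * (cosTransform ψ 1 / lam)
          * deriv (fun y => cosTransform ψ y / lam) ρ) := by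
  have hd : ∀ y, deriv (fun y => cosTransform ψ y / lam) y = deriv (cosTransform ψ) y / lam :=
    fun y => by simp only [div_eq_mul_inv, deriv_mul_const_field]
  have hsq : Real.sqrt ρ ≠ 0 := (Real.sqrt_pos.2 hρ).ne'
  have hρ0 : ρ ≠ 0 := hρ.ne'
  have h32 : ρ ^ ((3 : ℝ) / 2) = Real.sqrt ρ * ρ := by
    rw [show (3 : ℝ) / 2 = 1 / 2 + 1 by norm_num, Real.rpow_add hρ, Real.rpow_one,
      Real.sqrt_eq_rpow]
  have hm32 : ρ ^ (-(3 : ℝ) / 2) = (Real.sqrt ρ * ρ)⁻¹ := by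
    rw [show -(3 : ℝ) / 2 = -((3 : ℝ) / 2) by ring, Real.rpow_neg hρ.le, h32]
  have hint : (∫ x in ρ⁻¹..1, x * derivWithin ψ (Icc (-1) 1) x
        * ((ρ * x) * deriv (fun y => cosTransform ψ y / lam) (ρ * x)))
      = (∫ x in ρ⁻¹..1, scaleDerivIn ψ x * scaleDeriv (cosTransform ψ) (ρ * x)) / lam := by
    rw [eq_div_iff hlam, ← intervalIntegral.integral_mul_const]
    refine intervalIntegral.integral_congr fun x _ => ?_
    simp only [hd, scaleDerivIn, scaleDeriv]
    field_simp
  rw [hint, hd ρ, h32, hm32]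
  unfold sonineQTerm
  set A := ∫ x in ρ⁻¹..1, scaleDerivIn ψ x * scaleDeriv (cosTransform ψ) (ρ * x)
  simp only [scaleDerivIn, scaleDeriv, h1]
  field_simp

/-- RH-FREE. **"This formula shows, in particular, that the function `Qε(ρ)` is `0` for `ρ = 1`"** (p. 32;
Rem. 5.6), TERMWISE: `τ(n)T_n(1) = 0` — the integral is over `[1,1]` and the two boundary terms
`(D_uξ_n)(1)ζ_n(1) − ξ_n(1)(D_uζ_n)(1)` cancel because `ζ_n` continues `τ(n)ξ_n` smoothly across `x = 1`:
(74) `η̃ = λψ` on the CLOSED interval `[−1,1]` gives `η̃′(1) = λ·ψ′(1⁻)`.  PROVED from (74) as a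
hypothesis (the relation of seat t6's `IsAppEProlateDatum.cosTransform_eq`; it is Slepian's commutation,
seat t3's `CC2021_sec4_cosalphan`), for `ψ` continuous on `[−1,1]` and differentiable from the left at `1`.
[cite: ConnesConsani2021, Prop. 5.3 eq. (99) §5 p. 32 (arXiv chunk p0020:L83); Rem. 5.6 p. 34 (arXiv item Rem. 33, chunk p0021:L10)] -/
theorem sonineQTerm_one_eq_zero {ψ : ℝ → ℝ} {lam : ℝ} (hψc : ContinuousOn ψ (Icc (-1) 1))
    (hψd : DifferentiableWithinAt ℝ ψ (Icc (-1) 1) 1)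
    (h : ∀ x ∈ Icc (-1 : ℝ) 1, cosTransform ψ x = lam * ψ x) :
    sonineQTerm ψ lam 1 = 0 := by
  have hU : UniqueDiffWithinAt ℝ (Icc (-1 : ℝ) 1) 1 :=
    uniqueDiffOn_Icc (by norm_num) 1 (right_mem_Icc.2 (by norm_num))
  have h1 : (1 : ℝ) ∈ Icc (-1 : ℝ) 1 := right_mem_Icc.2 (by norm_num)
  -- `η̃′(1) = λ ψ′(1⁻)`
  have hderiv : deriv (cosTransform ψ) 1 = lam * derivWithin ψ (Icc (-1) 1) 1 := by
    have hda : DifferentiableAt ℝ (cosTransform ψ) 1 := (hasDerivAt_cosTransform hψc 1).differentiableAt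
    rw [← hda.derivWithin hU, derivWithin_congr (fun x hx => h x hx) (h 1 h1),
      derivWithin_const_mul _ hψd]
  simp only [sonineQTerm, Real.sqrt_one, inv_one, intervalIntegral.integral_same, mul_zero, zero_add,
    scaleDerivIn, scaleDeriv, one_mul, h 1 h1, hderiv]
  ring

/-! ## Lemma 5.4: the slope `ε′(1₊)` -/

/-- RH-FREE. **CC's `t(n) = λ(n)²(1−λ(n)²)⁻¹ ξ_n(1)²`** (p. 33), the `n`-th term of the series for `ε′(1⁺)`
(Lemma 5.4), in tree units: `ξ_n(1)² = 2ψ_n(1)²` (`∫_{−1}^1ξ_n² = 2` versus `∫_{−1}^1ψ² = 1`), `λ(n) =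
prolateLambda φ`; so `t(n) = epsSlopeTerm (ψ n)`.  Printed values (NUMERICAL IN PRINT, p. 33; recorded,
not asserted — the value is the cell engine's certified input): `t(0) = 11.9719, t(1) = 8.77574,
t(2) = 2.20528, t(3) = 0.0433983, t(4) = 0.000125459`, total "of the order of `22.9965`".
[cite: ConnesConsani2021, Lemma 5.4 §5 pp. 32–33 (arXiv item Lemma 31, chunk p0020:L86–L105)] -/
def epsSlopeTerm (φ : ℝ → ℝ) : ℝ :=
  2 * prolateLambda φ ^ 2 / (1 - prolateLambda φ ^ 2) * φ 1 ^ 2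

/-- RH-FREE. **Connes–Consani 2021, Lemma 5.4 (= arXiv item Lemma 31) — NAMED FACT (statement as printed;
no proof claimed here).**  "The derivative of `ε(ρ)` at `ρ = 1⁺` is `ε′(1⁺) = Σ_n λ(n)²(1−λ(n)²)⁻¹ξ_n(1)²`"
— together with "the convergence of the series is ensured by the inequality (100)" (p. 33).  Typed over
THE even prolate family: the series `Σ t(n)` (`epsSlopeTerm`) is summable and `ε = ccEpsilon ψ` has the
(real) right derivative `Σ' t(n)` at `ρ = 1` within `[1, ∞)`.  Equivalent additive form (`ρ = e^y`):
the right derivative of `epsDensity ψ` at `y = 0` is the same number (`hasDerivWithinAt_ccEpsilon_iff`);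
this is the `e′ = G′(0)` of (H-ε) (`deriv_eq_tsum_epsSlopeTerm_of_lemma_5_4`).  Printed proof: termwise
`∂_ρ|_{1⁺} ρ^{1/2}∫_{ρ⁻¹}^1 ξ^{an}(x)ξ^{an}(ρx)dx = ξ^{an}(1)² = ξ_n(1)²` (uses (74) at `x = 1`) and
term-by-term differentiation (App. F bounds).  Numerically `≃ 22.9965` (p. 33; NUMERICAL IN PRINT, not asserted here).
[cite: ConnesConsani2021, Lemma 5.4 §5 pp. 32–33 (arXiv item Lemma 31, chunk p0020:L86–L101)] -/
def CC2021_lemma_5_4 : Prop :=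
  ∀ ψ : ℕ → ℝ → ℝ, (∀ n, IsProlateFunction 1 (2 * n) (ψ n)) →
    Summable (fun n => epsSlopeTerm (ψ n)) ∧
      HasDerivWithinAt (ccEpsilon ψ) (((∑' n, epsSlopeTerm (ψ n) : ℝ)) : ℂ) (Ici 1) 1

/-- RH-FREE. **Slope at `ρ = 1⁺` ↔ slope at `y = 0⁺`**: `ε = ccEpsilon ψ` has right derivative `e` at
`ρ = 1` iff `ε ∘ exp = epsDensity ψ` has right derivative `e` at `y = 0` (`exp′(0) = 1 = log′(1)`,
`exp [0,∞) = [1,∞)`). [cite: ConnesConsani2021, Lemma 5.4 §5 p. 32; §5 eq. (101) p. 33 ("passing to the additive scale")] -/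
theorem hasDerivWithinAt_ccEpsilon_iff (ψ : ℕ → ℝ → ℝ) (e : ℂ) :
    HasDerivWithinAt (ccEpsilon ψ) e (Ici 1) 1 ↔ HasDerivWithinAt (epsDensity ψ) e (Ici 0) 0 := by
  constructor
  · intro h
    have hexp : HasDerivWithinAt Real.exp (Real.exp 0) (Ici (0 : ℝ)) 0 :=
      (Real.hasDerivAt_exp 0).hasDerivWithinAt
    have hmaps : MapsTo Real.exp (Ici (0 : ℝ)) (Ici 1) := fun y hy => by
      simpa using Real.one_le_exp (mem_Ici.1 hy)
    have h' : HasDerivWithinAt (ccEpsilon ψ) e (Ici 1) (Real.exp 0) := by rwa [Real.exp_zero]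
    have hc := h'.scomp (0 : ℝ) hexp hmaps
    rw [Real.exp_zero, one_smul] at hc
    refine hc.congr_of_eventuallyEq (Eventually.of_forall fun y => ?_) ?_
    · simp [Function.comp, ccEpsilon, Real.log_exp]
    · simp [ccEpsilon]
  · intro h
    have hlog : HasDerivWithinAt Real.log (1 : ℝ)⁻¹ (Ici (1 : ℝ)) 1 :=
      (Real.hasDerivAt_log one_ne_zero).hasDerivWithinAt
    have hmaps : MapsTo Real.log (Ici (1 : ℝ)) (Ici 0) := fun ρ hρ =>
      mem_Ici.2 (Real.log_nonneg (mem_Ici.1 hρ))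
    have h' : HasDerivWithinAt (epsDensity ψ) e (Ici 0) (Real.log 1) := by rwa [Real.log_one]
    have hc := h'.scomp (1 : ℝ) hlog hmaps
    rw [inv_one, one_smul] at hc
    exact hc.congr_of_eventuallyEq (Eventually.of_forall fun ρ => rfl) rfl

/-- RH-FREE. **(H-ε)'s `e′` IS Lemma 5.4's series**: for every `C²` archimedean density `G` (the `G` of
`MainInequalityAssembly`, route predicate `IsArchDensity`: `G = ε ∘ exp` on `[0,∞)`) and the even prolate
family `ψ`, Lemma 5.4 gives `G′(0) = Σ' t(n) = ε′(1₊)` (the two-sided derivative of the extension is its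
right derivative, which is that of `ε ∘ exp`).
[cite: ConnesConsani2021, Lemma 5.4 §5 p. 32 (arXiv item Lemma 31); Thm. 6.11 proof §6.7 p. 48 ("`N_I = −2ε′(1₊)(1−𝐊_I)`")] -/
theorem deriv_eq_tsum_epsSlopeTerm_of_lemma_5_4 (h4 : CC2021_lemma_5_4) {G : ℝ → ℂ}
    (hG : ContDiff ℝ 2 G) (hGa : IsArchDensity G) {ψ : ℕ → ℝ → ℝ}
    (hψ : ∀ n, IsProlateFunction 1 (2 * n) (ψ n)) :
    deriv G 0 = ((∑' n, epsSlopeTerm (ψ n) : ℝ) : ℂ) := by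
  have hU : UniqueDiffWithinAt ℝ (Ici (0 : ℝ)) 0 := uniqueDiffOn_Ici 0 0 self_mem_Ici
  have hGd : DifferentiableAt ℝ G 0 := (hG.differentiable (by norm_num)) 0
  have hε : HasDerivWithinAt (epsDensity ψ) ((∑' n, epsSlopeTerm (ψ n) : ℝ) : ℂ) (Ici 0) 0 :=
    (hasDerivWithinAt_ccEpsilon_iff ψ _).1 (h4 ψ hψ).2
  have hGε : HasDerivWithinAt G ((∑' n, epsSlopeTerm (ψ n) : ℝ) : ℂ) (Ici 0) 0 :=
    hε.congr (fun x hx => hGa ψ hψ x (mem_Ici.1 hx)) (hGa ψ hψ 0 le_rfl)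
  rw [← hGd.derivWithin hU, hGε.derivWithin hU]

/-! ### `ε` is real: the imaginary-part clause of K2 is analytic -/

/-- RH-FREE. **`𝔽_{e_ℝ}ξ_n` is the real cosine transform**: for a real EVEN function `φ` vanishing off
`[−1,1]` and continuous there, Mathlib's Fourier integral of `x ↦ (φ x : ℂ)` (kernel `e^{−2πixv}`,
eq. (13) p. 7) is `∫_{−1}^1 φ(x)cos(2πxv)dx = cosTransform φ v` (seat t6's real form; the sine part is odd).
This identifies seat t4's `prolateCutFourier (ψ n)` with `cosTransform (ψ n)` on `|v| ≥ 1`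
(`prolateCutFourier_eq_ofReal`): CC's `ψ_n = Pη_n`, `η_n = 𝔽ξ_n` real (Prop. 4.5 (iii) "the functions
`ψ_n` are real valued"). [cite: ConnesConsani2021, Prop. 4.5 (iii) §4 p. 25 (arXiv item Prop. 25, chunk p0017:L1); eq. (13) §1 p. 7] -/
theorem fourier_ofReal_eq_cosTransform {φ : ℝ → ℝ} (heven : ∀ x, φ (-x) = φ x)
    (hsupp : ∀ x : ℝ, 1 < |x| → φ x = 0) (hcont : ContinuousOn φ (Icc (-1) 1)) (v : ℝ) :
    FourierTransform.fourier (fun u : ℝ => (φ u : ℂ)) v = (cosTransform φ v : ℂ) := by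
  -- `φ` is its own restriction to `[−1,1]`
  have hind : ∀ g : ℝ → ℝ, (fun x => φ x * g x) = (Icc (-1 : ℝ) 1).indicator (fun x => φ x * g x) := by
    intro g
    funext x
    by_cases hx : x ∈ Icc (-1 : ℝ) 1
    · rw [indicator_of_mem hx]
    · rw [indicator_of_notMem hx, hsupp x, zero_mul]
      rw [mem_Icc, not_and_or, not_le, not_le] at hx
      rcases hx with h | h
      · rw [abs_of_neg (by linarith)]; linarith
      · rw [abs_of_pos (by linarith)]; exact h
  have hint : ∀ g : ℝ → ℝ, Continuous g → Integrable (fun x => φ x * g x) := by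
    intro g hg
    rw [hind g, integrable_indicator_iff measurableSet_Icc]
    exact ((hcont.mul hg.continuousOn).integrableOn_compact isCompact_Icc).mono_set Subset.rfl
  have hcos : Integrable fun x => φ x * Real.cos (2 * π * x * v) := hint _ (by fun_prop)
  have hsin : Integrable fun x => φ x * Real.sin (2 * π * x * v) := hint _ (by fun_prop)
  -- split `e^{−iθ} = cos θ − i sin θ`
  have hsplit : ∀ x : ℝ, Complex.exp (↑(-2 * π * x * v) * Complex.I) • ((φ x : ℝ) : ℂ)
      = ((φ x * Real.cos (2 * π * x * v) : ℝ) : ℂ)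
        - ((φ x * Real.sin (2 * π * x * v) : ℝ) : ℂ) * Complex.I := by
    intro x
    rw [Complex.exp_mul_I, smul_eq_mul]
    push_cast
    rw [show -2 * (π : ℂ) * x * v = -(2 * π * x * v) by ring, Complex.cos_neg, Complex.sin_neg]
    ring
  have hcosC : Integrable fun x => ((φ x * Real.cos (2 * π * x * v) : ℝ) : ℂ) := hcos.ofReal
  have hsinC : Integrable fun x => ((φ x * Real.sin (2 * π * x * v) : ℝ) : ℂ) * Complex.I :=
    hsin.ofReal.mul_const _
  rw [Real.fourier_real_eq_integral_exp_smul]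
  simp_rw [hsplit]
  rw [MeasureTheory.integral_sub hcosC hsinC, MeasureTheory.integral_mul_const, integral_complex_ofReal,
    integral_complex_ofReal]
  -- the sine part vanishes by oddness
  have hodd : ∫ x, φ x * Real.sin (2 * π * x * v) = 0 := by
    have h := integral_neg_eq_self (fun x => φ x * Real.sin (2 * π * x * v)) volume
    have h' : (fun x => φ (-x) * Real.sin (2 * π * (-x) * v))
        = fun x => -(φ x * Real.sin (2 * π * x * v)) := by
      funext x
      rw [heven, show 2 * π * (-x) * v = -(2 * π * x * v) by ring, Real.sin_neg]
      ring
    rw [h', MeasureTheory.integral_neg] at h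
    linarith
  -- the cosine part is the interval integral
  have hcosI : ∫ x, φ x * Real.cos (2 * π * x * v) = cosTransform φ v := by
    rw [hind, MeasureTheory.integral_indicator measurableSet_Icc,
      MeasureTheory.integral_Icc_eq_integral_Ioc,
      ← intervalIntegral.integral_of_le (by norm_num : (-1 : ℝ) ≤ 1), cosTransform]
  rw [hodd, hcosI]
  simp

/-- RH-FREE. Seat t4's cut Fourier transform is real: `prolateCutFourier φ v = 1_{|v|≥1}·cosTransform φ v`
for the even real prolate function (the `ψ_n = Pη_n` of Prop. 4.5 (iii), real valued).
[cite: ConnesConsani2021, Prop. 4.5 (iii) §4 p. 25 (arXiv item Prop. 25, chunk p0017:L1)] -/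
theorem prolateCutFourier_eq_ofReal {φ : ℝ → ℝ} (heven : ∀ x, φ (-x) = φ x)
    (hsupp : ∀ x : ℝ, 1 < |x| → φ x = 0) (hcont : ContinuousOn φ (Icc (-1) 1)) (v : ℝ) :
    prolateCutFourier φ v = ((if 1 ≤ |v| then cosTransform φ v else 0 : ℝ) : ℂ) := by
  unfold prolateCutFourier
  split_ifs with h
  · exact fourier_ofReal_eq_cosTransform heven hsupp hcont v
  · simp

/-- RH-FREE. **Each term of (sonine0) is real** ("`ε(ρ)` … real valued": the `ξ_n, ζ_n` are real, Prop.
4.5 (iii)): `Im epsTerm (ψ n) y = 0` for a tree prolate function.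
[cite: ConnesConsani2021, Thm. 4.7 eq. (84) §4 p. 27 (arXiv chunk p0018:L37–L40); Prop. 4.5 (iii) p. 25] -/
theorem epsTerm_im {m : ℕ} {φ : ℝ → ℝ} (hφ : IsProlateFunction 1 m φ) (y : ℝ) :
    (epsTerm φ y).im = 0 := by
  have hcont : ContinuousOn φ (Icc (-1) 1) := by simpa using hφ.contDiffOn.continuousOn
  have hreal : scalingCoeff (fun v => (φ v : ℂ)) (prolateCutFourier φ) (-y)
      = ((∫ v, φ v * (Real.exp (-(-y) / 2)
          * (if 1 ≤ |Real.exp (-(-y)) * v| then cosTransform φ (Real.exp (-(-y)) * v) else 0)) : ℝ)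
          : ℂ) := by
    rw [scalingCoeff, ← integral_complex_ofReal]
    refine integral_congr_ae (Eventually.of_forall fun v => ?_)
    dsimp only
    rw [prolateCutFourier_eq_ofReal hφ.even hφ.support hcont, Complex.conj_ofReal]
    push_cast
    ring
  rw [epsTerm, hreal, ← Complex.ofReal_mul, Complex.ofReal_im]

/-- RH-FREE. **The density `ε ∘ exp` is real**: `Im epsDensity ψ y = 0` for the even prolate family.
[cite: ConnesConsani2021, Thm. 4.7 eq. (84) §4 p. 27 (arXiv chunk p0018:L37–L40)] -/
theorem epsDensity_im {ψ : ℕ → ℝ → ℝ} (hψ : ∀ n, IsProlateFunction 1 (2 * n) (ψ n)) (y : ℝ) :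
    (epsDensity ψ y).im = 0 := by
  have h : ∀ n, epsTerm (ψ n) |y| = (((epsTerm (ψ n) |y|).re : ℝ) : ℂ) := fun n =>
    Complex.ext (by simp) (by simp [epsTerm_im (hψ n)])
  rw [epsDensity, tsum_congr h, ← Complex.ofReal_tsum, Complex.ofReal_im]

/-- RH-FREE. An archimedean density is real on `[0, ∞)`. [cite: ConnesConsani2021, Thm. 4.7 eq. (84) §4 p. 27; §5 eq. (101) p. 33] -/
theorem IsArchDensity.im_eq_zero {G : ℝ → ℂ} (hG : IsArchDensity G) {x : ℝ} (hx : 0 ≤ x) :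
    (G x).im = 0 := by
  obtain ⟨ψ, hψ⟩ := exists_prolateFamily
  rw [hG ψ hψ x hx, epsDensity_im hψ]

/-- RH-FREE. **The imaginary-part clause of K2 is analytic**: for every `C²` archimedean density `G`,
`Im G′(0) = 0` — `G` is real on `[0,∞)` (`IsArchDensity.im_eq_zero`), so its right derivative at `0`,
which is `G′(0)`, is real.  Unconditional (no series interchange, no numerics); the INTERVAL clause
`22.9 ≤ Re G′(0) ≤ 23.1` is the numerical input (`densitySlope_of_lemma_5_4`).
[cite: ConnesConsani2021, Lemma 5.4 §5 p. 32 (arXiv item Lemma 31, chunk p0020:L86–L88)] -/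
theorem im_deriv_eq_zero_of_isArchDensity {G : ℝ → ℂ} (hG : ContDiff ℝ 2 G) (hGa : IsArchDensity G) :
    (deriv G 0).im = 0 := by
  have hU : UniqueDiffWithinAt ℝ (Ici (0 : ℝ)) 0 := uniqueDiffOn_Ici 0 0 self_mem_Ici
  have hGd : HasDerivWithinAt G (deriv G 0) (Ici 0) 0 :=
    ((hG.differentiable (by norm_num)) 0).hasDerivAt.hasDerivWithinAt
  have him : HasDerivWithinAt (fun x => Complex.imCLM (G x)) (Complex.imCLM (deriv G 0)) (Ici 0) 0 :=
    Complex.imCLM.hasFDerivAt.comp_hasDerivWithinAt 0 hGd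
  have hzero : HasDerivWithinAt (fun x => Complex.imCLM (G x)) 0 (Ici 0) 0 :=
    (hasDerivWithinAt_const (0 : ℝ) (Ici (0 : ℝ)) (0 : ℝ)).congr
      (fun x hx => by simp [hGa.im_eq_zero (mem_Ici.1 hx)]) (by simp [hGa.im_eq_zero le_rfl])
  have := hU.eq_deriv _ him hzero
  simpa using this

/-- RH-FREE. **The route binder K2 `DensitySlope` from Lemma 5.4 and an enclosure of its series**
(routes-1 shape, cc/STATUS 2026-08-26T02:03:42Z; route «ConnesConsaniSemilocal» item `DensitySlope`
up to the spelling of the density predicate): for every `C²` archimedean density `G`,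
`Im G′(0) = 0 ∧ 22.9 ≤ Re G′(0) ≤ 23.1`, GIVEN Lemma 5.4 (series identity, RH-free) and the numerical
enclosure `22.9 ≤ Σ_n t(n) ≤ 23.1` of its series as a HYPOTHESIS — printed value `22.9965`
(`t(0…4) = 11.9719, 8.77574, 2.20528, 0.0433983, 0.000125459`, p. 33, NUMERICAL IN PRINT; cell
in-house `22.99647568`); by the cell's ruling (cc-lead 2026-08-26T03:07:27Z) the value is certified by
the §6 engine's single numerical fact and is NOT minted as a named fact here.  The `Im` clause does not
need the hypothesis (`im_deriv_eq_zero_of_isArchDensity`).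
[cite: ConnesConsani2021, Lemma 5.4 §5 pp. 32–33 (arXiv item Lemma 31, chunk p0020:L86–L106)] -/
theorem densitySlope_of_lemma_5_4 (h4 : CC2021_lemma_5_4)
    (henc : ∀ ψ : ℕ → ℝ → ℝ, (∀ n, IsProlateFunction 1 (2 * n) (ψ n)) →
      (22.9 : ℝ) ≤ ∑' n, epsSlopeTerm (ψ n) ∧ ∑' n, epsSlopeTerm (ψ n) ≤ 23.1) :
    ∀ G : ℝ → ℂ, ContDiff ℝ 2 G → IsArchDensity G →
      (deriv G 0).im = 0 ∧ (22.9 : ℝ) ≤ (deriv G 0).re ∧ (deriv G 0).re ≤ 23.1 := by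
  intro G hG hGa
  obtain ⟨ψ, hψ⟩ := exists_prolateFamily
  obtain ⟨hlo, hhi⟩ := henc ψ hψ
  rw [deriv_eq_tsum_epsSlopeTerm_of_lemma_5_4 h4 hG hGa hψ, Complex.ofReal_im, Complex.ofReal_re]
  exact ⟨rfl, hlo, hhi⟩

/-- RH-FREE. **Eq. (102) with `ε′(1₊)` named**: for a `C²` archimedean density `G` and a `C²` test
function `F` of compact support, `E₊(Q₊F) = −2ε′(1₊)F(0) + ∫_0^∞ (F(x)+F(−x))(QG)(x)dx` with
`ε′(1₊) = Σ' t(n)` (Lemma 5.4) — `JumpFormula.evenFunctional_opQ` (the tree's (Qprime)/(Eprime) for a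
generic `C²` branch) with `G′(0)` identified by `deriv_eq_tsum_epsSlopeTerm_of_lemma_5_4`; for `x > 0`,
`(QG)(x) = opQ G x` is `(Qε)(e^x)` (`opQ_archDensity_eq_mulOpQ`).
[cite: ConnesConsani2021, §5 eq. (102) p. 33 (arXiv chunk p0020:L107–L113)] -/
theorem evenFunctional_opQ_archDensity (h4 : CC2021_lemma_5_4) {G F : ℝ → ℂ} (hG : ContDiff ℝ 2 G)
    (hGa : IsArchDensity G) (hF : ContDiff ℝ 2 F) (hFs : HasCompactSupport F) {ψ : ℕ → ℝ → ℝ}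
    (hψ : ∀ n, IsProlateFunction 1 (2 * n) (ψ n)) :
    evenFunctional G (opQ F)
      = -2 * ((∑' n, epsSlopeTerm (ψ n) : ℝ) : ℂ) * F 0 + ∫ x in Ioi 0, (F x + F (-x)) * opQ G x := by
  rw [evenFunctional_opQ hF hFs hG, deriv_eq_tsum_epsSlopeTerm_of_lemma_5_4 h4 hG hGa hψ]

/-- RH-FREE. **`(QG)(x) = (Qε)(e^x)` for `x > 0`**: a `C²` archimedean density agrees with `ε ∘ exp` on the
open half-line, so its `opQ` there is CC's `Qε` in the multiplicative variable (Prop. 5.3's left side),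
granted Prop. 5.3's regularity clause. [cite: ConnesConsani2021, Prop. 5.3 eq. (97) §5 p. 32; eq. (102) p. 33] -/
theorem opQ_archDensity_eq_mulOpQ (h3 : CC2021_prop_5_3) {G : ℝ → ℂ} (hGa : IsArchDensity G)
    {ψ : ℕ → ℝ → ℝ} (hψ : ∀ n, IsProlateFunction 1 (2 * n) (ψ n)) {x : ℝ} (hx : 0 < x) :
    opQ G x = mulOpQ (ccEpsilon ψ) (Real.exp x) := by
  have hreg := (h3 ψ hψ).1
  -- `G = ccEpsilon ψ ∘ exp` near `x`
  have hEq : G =ᶠ[𝓝 x] fun t => ccEpsilon ψ (Real.exp t) := by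
    filter_upwards [Ioi_mem_nhds hx] with t ht
    rw [hGa ψ hψ t (le_of_lt ht), ccEpsilon, Real.log_exp]
  have hEq' : deriv (deriv G) x = deriv (deriv fun t => ccEpsilon ψ (Real.exp t)) x := by
    have : deriv G =ᶠ[𝓝 x] deriv fun t => ccEpsilon ψ (Real.exp t) := hEq.deriv
    exact this.deriv_eq
  have hopen : IsOpen (Ioi (1 : ℝ)) := isOpen_Ioi
  have hex : Real.exp x ∈ Ioi (1 : ℝ) := mem_Ioi.2 (Real.one_lt_exp_iff.2 hx)
  obtain ⟨hdiff, -, hC1⟩ := (contDiffOn_succ_iff_deriv_of_isOpen (n := 1) hopen).1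
    (by simpa [one_add_one_eq_two] using hreg)
  have h1 : ∀ᶠ r in 𝓝 (Real.exp x), DifferentiableAt ℝ (ccEpsilon ψ) r := by
    filter_upwards [hopen.mem_nhds hex] with r hr
    exact (hdiff r hr).differentiableAt (hopen.mem_nhds hr)
  have h2 : DifferentiableAt ℝ (fun r : ℝ => r • deriv (ccEpsilon ψ) r) (Real.exp x) := by
    have hd : DifferentiableAt ℝ (deriv (ccEpsilon ψ)) (Real.exp x) :=
      ((hC1.differentiableOn one_ne_zero) _ hex).differentiableAt (hopen.mem_nhds hex)
    exact differentiableAt_id.smul hd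
  rw [opQ_apply, hEq', hEq.self_of_nhds, ← opQ_apply, opQ_comp_exp h1 h2]

/-! ## The prolate input (100): [Rokhlin–Xiao 2007, Theorem 12] — NOT typed as a fact

Connes–Consani's eq. (100) quotes [Rokhlin–Xiao 2007, Thm. 12 eq. (66)]: "for any `c > 0` and integer
`m ≥ 0`, `ψ_m^c(1) < (m + ½)^{1/2}`" (`‖ψ_m^c‖_{L²[−1,1]} = 1`; in the tree's normalisation of
`IsProlateFunction lam m f`, bandwidth `c = 2πλ²` on `[−λ,λ]`: `λ^{1/2}|f(λ)| < (m+½)^{1/2}`; CC's instance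
is `c = 2π`, `m = 2n`, and for their `ξ_n = √2ψ_n` it reads `|ξ_n(1)| < (4n+1)^{1/2}`, ERRATUM above).
**This inequality has NO printed proof**: Rokhlin–Xiao list (66) in their §4 «Formulae» ("obtained [with]
Mathematica … verified by substitution", loc. cit. p. 114), and Bonami–Karoui (C. R. Math. 352 (2014),
p. 230) call it "an emblematic estimate frequently cited (but not proved) … numerically justified in
[Xiao–Rokhlin–Yarvin 2001], while an analytic proof of this inequality seems to be difficult to obtain";
what Bonami–Karoui PROVE is `ψ_{n,c}(1) ≤ κ₁χ_n(c)^{1/4} ≤ 2.35·(n+1)^{1/2}` for `c² ≤ χ_n(c)`,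
`κ₁ = (5/4)·5^{1/4}` (loc. cit. Thm. 3.1 eq. (12)); Osipov (ACHA 35 (2013), Thm. 5) and Hogan–Lakey (2011,
eq. (2.64)) restate (66) citing Rokhlin–Xiao.  By the Literature rule (a named fact cites a source that
PROVES it; cell rulings R55, FACT-LIST R1) it is therefore NOT a `def … : Prop` of this file (an earlier
revision carried it as `RokhlinXiao2007_thm_12` with the bridges `sqrt_two_mul_abs_apply_one_lt`,
`abs_apply_one_lt_of_thm_12`; removed 2026-08-26, no consumer).  The cell's chain to `G ∈ C²` / `ε′(1₊)`
does not need it: the boundary terms of App. F are controlled WITHOUT any endpoint bound (seat gm-t16,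
`ArchDensityRegularityCore.lean`, companion of `ArchDensityRegularity.lean`: the prolate equation at `x = 1`
gives `|λ(n)|·|χ_n − 4π²|·|ψ_n(1)| ≤ 198π/35`), and a PROVED endpoint bound of Bonami–Karoui type is seat t6's
`LFunctions/ProlateEndpointBound.lean` (the printed statement typed as `BonamiKaroui2014_eq_4`, seat t8).
Numerically, at `c = 2π`: `ψ_m(1)²/(m+½) = 0.0007, 0.0087, 0.074, 0.31, 0.65, 0.88, 0.96, 0.98, …`
increasing to `1⁻` (margin `≈ (4c²+c⁴)/(2(2m+1)⁴)`, Rokhlin–Xiao (67)); cell computation j251238.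
[cite: RokhlinXiao2007, Thm. 12 p. 116 (eq. (66)); BonamiKaroui2014, p. 230 and Thm. 3.1 eq. (12) p. 231;
ConnesConsani2021, §5 eq. (100) p. 33 (arXiv chunk p0020:L98–L101)] -/

/-! ## Remark 5.6: `Qε(1) = 0` — the kernel of `𝐊_I` vanishes on the diagonal -/

/-- RH-FREE. **Connes–Consani 2021, Remark 5.6 (= arXiv item Rem. 33) — NAMED FACT (statement as printed; no
proof claimed here).**  "The function `Qε(ρ)` is `0` for `ρ = 1`.  This shows that the integral of diagonal
values of the Schwartz kernel defining the compact operator `𝐊_I` is `0` independently of the size of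
`I`."  Read on the `C²` branch at `ρ = 1⁺` (the two-sided `ε` has a kink at `1`, Lemma 5.4): for every
`C²` archimedean density `G` (`G = ε ∘ exp` on `[0,∞)`, as consumed by `JumpFormula.varpi`/`opN`),
`(QG)(0) = opQ G 0 = −G″(0) + G(0)/4 = 0`; since `G(0) = ε(1) = 0` (`IsArchDensity.apply_zero`) this is
`G″(0⁺) = 0`, and the kernel `ϖ_G(v) = (opQ G)(|v|)/(2G′(0))` of `𝐊_I = windowOp ϖ_G` vanishes at `v = 0`
(`varpi_zero_of_rem_5_6`).  In print it follows from (99) at `ρ = 1` (termwise: `sonineQTerm_one_eq_zero`)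
and the continuity of the series (App. F).  Non-vacuous exactly when `ε ∘ exp` is `C²` on `[0,∞)` (route
item K0 `DensityRegular`).
[cite: ConnesConsani2021, Rem. 5.6 §5 p. 34 (arXiv item Rem. 33, chunk p0021:L10)] -/
def CC2021_rem_5_6 : Prop :=
  ∀ G : ℝ → ℂ, ContDiff ℝ 2 G → IsArchDensity G → opQ G 0 = 0

/-- RH-FREE. Rem. 5.6 ⇒ **the kernel `ϖ` of `𝐊_I` vanishes on the diagonal**: `ϖ_G(0) = (opQ G)(0)/(2G′(0)) = 0`
("the integral of diagonal values of the Schwartz kernel … is `0` independently of the size of `I`";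
contrast Thm. 3.6's `K_I`, "whose trace is proportional to the length").
[cite: ConnesConsani2021, Rem. 5.6 §5 p. 34 (arXiv item Rem. 33, chunk p0021:L10–L11)] -/
theorem varpi_zero_of_rem_5_6 (h : CC2021_rem_5_6) {G : ℝ → ℂ} (hG : ContDiff ℝ 2 G)
    (hGa : IsArchDensity G) : varpi G 0 = 0 := by
  simp [varpi, h G hG hGa]

/-- RH-FREE. Rem. 5.6 with `G(0) = ε(1) = 0`: the `C²` branch has vanishing SECOND derivative at `0⁺`,
`G″(0) = 0` (while `G′(0) = ε′(1₊) ≃ 23`, Lemma 5.4).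
[cite: ConnesConsani2021, Rem. 5.6 §5 p. 34 (arXiv item Rem. 33, chunk p0021:L10)] -/
theorem deriv_deriv_zero_of_rem_5_6 (h : CC2021_rem_5_6) {G : ℝ → ℂ} (hG : ContDiff ℝ 2 G)
    (hGa : IsArchDensity G) : deriv (deriv G) 0 = 0 := by
  have h0 := h G hG hGa
  rw [opQ_apply, hGa.apply_zero, mul_zero, add_zero, neg_eq_zero] at h0
  exact h0


/-! ## Discharge of Lemma 5.2 (`CC2021_lemma_5_2_holds`)

The printed hypotheses (`ξ ∈ C^∞((0,1])`, `ζ ∈ C^∞([1,∞))`, `ρ ∈ (1,2]`) are LOCALISED to the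
data of seat gm-t16's proved form of Lemma 5.2 (`ScalingCoeffBoundaryTerms.opQ_truncScalingCoeff_eq`:
`ξ₁ ∈ C²` on `[−1,1]`, `η₁ ∈ C²(ℝ)`, every `ρ > 1`): by the finite-order Whitney extension
(`Literature.Analysis.Calculus.exists_contDiff_extension_Icc_deriv` / `_Ici_deriv`) there are
`ξ₁ ∈ C²(ℝ)` agreeing with `ξ` on `[¼, 1]` and `η₁ ∈ C²(ℝ)` agreeing with `ζ` on `[1, ∞)`; since
`k(r) = r^{1/2}∫_{r⁻¹}^1 ξ(x)ζ(rx)dx` only reads `ξ` on `[r⁻¹, 1]` and `ζ` on `[1, r]`, the two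
coefficients agree for `r ∈ (1, 4)`, hence have the same `Q` at `ρ`, and the right-hand sides agree
term by term (the one-sided `D_uξ` at `1` is the same left derivative; the lower endpoint `x = ρ⁻¹`,
where `D_uζ` would be read AT `1`, is Lebesgue-null). -/

section Lemma52Discharge

open Literature.Analysis.Calculus

variable {ξ ζ ξ₁ η₁ : ℝ → ℝ}

/-- RH-FREE. `Icc a b` and `Icc a' b` coincide near a point to the right of both `a, a'`.
[folklore] -/
private theorem Icc_eventuallyEq_Icc {a a' b t : ℝ} (ha : a < t) (ha' : a' < t) :
    (Icc a b : Set ℝ) =ᶠ[𝓝 t] (Icc a' b : Set ℝ) := by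
  rw [Filter.eventuallyEq_set]
  filter_upwards [Ioi_mem_nhds ha, Ioi_mem_nhds ha'] with s hs hs'
  simp only [mem_Icc, (le_of_lt (mem_Ioi.1 hs)), (le_of_lt (mem_Ioi.1 hs')), true_and, iff_self]

/-- RH-FREE. If `ξ₁ ∈ C¹(ℝ)` agrees with `ξ` on `[¼, 1]` with `ξ₁′ = ξ′_{[¼,1]}` there, then the
one-sided scaling derivatives within `[−1,1]` agree on `[½, 1]`:
`scaleDerivIn ξ t = scaleDerivIn ξ₁ t`. [folklore] -/
private theorem scaleDerivIn_congr_of_extension (hξ₁ : ContDiff ℝ 2 ξ₁)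
    (hD : ∀ x ∈ Icc (1 / 4 : ℝ) 1, deriv ξ₁ x = derivWithin ξ (Icc (1 / 4) 1) x)
    {t : ℝ} (ht : t ∈ Icc (1 / 2 : ℝ) 1) : scaleDerivIn ξ t = scaleDerivIn ξ₁ t := by
  have ht4 : (1 / 4 : ℝ) < t := by linarith [ht.1]
  have htm : t ∈ Icc (-1 : ℝ) 1 := ⟨by linarith [ht.1], ht.2⟩
  have hU : UniqueDiffWithinAt ℝ (Icc (-1 : ℝ) 1) t := uniqueDiffOn_Icc (by norm_num) t htm
  have h1 : derivWithin ξ (Icc (-1) 1) t = derivWithin ξ (Icc (1 / 4) 1) t :=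
    derivWithin_congr_set (Icc_eventuallyEq_Icc (by linarith [ht.1]) ht4)
  have h2 : derivWithin ξ₁ (Icc (-1) 1) t = deriv ξ₁ t :=
    ((hξ₁.differentiable (by norm_num)) t).derivWithin hU
  simp only [scaleDerivIn, h1, h2, hD t ⟨ht4.le, ht.2⟩]

/-- RH-FREE. Localisation of the coefficient: if `ξ₁ = ξ` on `[¼,1]` and `η₁ = ζ` on `[1,∞)` then
`cutCoeff ξ ζ = cutCoeff ξ₁ η₁` on `(1, 4)`. [folklore] -/
private theorem cutCoeff_congr_local (hξe : EqOn ξ₁ ξ (Icc (1 / 4) 1)) (hζe : EqOn η₁ ζ (Ici 1))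
    {r : ℝ} (hr : r ∈ Ioo (1 : ℝ) 4) : cutCoeff ξ ζ r = cutCoeff ξ₁ η₁ r := by
  have hr0 : 0 < r := by linarith [hr.1]
  have hri : (1 / 4 : ℝ) < r⁻¹ := by
    rw [lt_inv_comm₀ (by norm_num) hr0]
    norm_num
    exact hr.2
  have hri1 : r⁻¹ ≤ 1 := inv_le_one_of_one_le₀ hr.1.le
  simp only [cutCoeff]
  congr 1
  refine intervalIntegral.integral_congr fun t ht => ?_
  rw [uIcc_of_le hri1] at ht
  have hx : t ∈ Icc (1 / 4 : ℝ) 1 := ⟨hri.le.trans ht.1, ht.2⟩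
  have hrt : r * t ∈ Ici (1 : ℝ) := by
    have : r⁻¹ * r ≤ t * r := mul_le_mul_of_nonneg_right ht.1 hr0.le
    rw [inv_mul_cancel₀ hr0.ne'] at this
    simpa [mem_Ici, mul_comm] using this
  simp only [hξe hx, hζe hrt]

/-- RH-FREE. Localisation of the right-hand side of (96) for `ρ ∈ (1,2]`. [folklore] -/
private theorem cutCoeffQ_congr_local (hξ₁ : ContDiff ℝ 2 ξ₁) (hξe : EqOn ξ₁ ξ (Icc (1 / 4) 1))
    (hD : ∀ x ∈ Icc (1 / 4 : ℝ) 1, deriv ξ₁ x = derivWithin ξ (Icc (1 / 4) 1) x)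
    (hζe : EqOn η₁ ζ (Ici 1)) (hζD : ∀ x, 1 < x → deriv η₁ x = deriv ζ x)
    {ρ : ℝ} (hρ : ρ ∈ Ioc (1 : ℝ) 2) : cutCoeffQ ξ ζ ρ = cutCoeffQ ξ₁ η₁ ρ := by
  have hρ0 : 0 < ρ := by linarith [hρ.1]
  have hri : (1 / 2 : ℝ) ≤ ρ⁻¹ := by
    rw [le_inv_comm₀ (by norm_num) hρ0]
    norm_num
    exact hρ.2
  have hri1 : ρ⁻¹ < 1 := inv_lt_one_of_one_lt₀ hρ.1
  -- the integral: agree on `(ρ⁻¹, 1]` (the left endpoint is null)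
  have hI : (∫ x in ρ⁻¹..1, scaleDerivIn ξ x * scaleDeriv ζ (ρ * x))
      = ∫ x in ρ⁻¹..1, scaleDerivIn ξ₁ x * scaleDeriv η₁ (ρ * x) := by
    refine intervalIntegral.integral_congr_ae (Eventually.of_forall fun x hx => ?_)
    rw [uIoc_of_le hri1.le] at hx
    have hx' : x ∈ Icc (1 / 2 : ℝ) 1 := ⟨hri.trans hx.1.le, hx.2⟩
    have hρx : 1 < ρ * x := by
      have : ρ⁻¹ * ρ < x * ρ := mul_lt_mul_of_pos_right hx.1 hρ0
      rw [inv_mul_cancel₀ hρ0.ne'] at this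
      simpa [mul_comm] using this
    rw [scaleDerivIn_congr_of_extension hξ₁ hD hx', scaleDeriv, scaleDeriv, hζD _ hρx]
  have e1 : scaleDerivIn ξ ρ⁻¹ = scaleDerivIn ξ₁ ρ⁻¹ :=
    scaleDerivIn_congr_of_extension hξ₁ hD ⟨hri, hri1.le⟩
  have e2 : ζ 1 = η₁ 1 := (hζe self_mem_Ici).symm
  have e3 : ξ 1 = ξ₁ 1 := (hξe ⟨by norm_num, le_rfl⟩).symm
  have e4 : scaleDeriv ζ ρ = scaleDeriv η₁ ρ := by simp only [scaleDeriv, hζD ρ hρ.1]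
  simp only [cutCoeffQ, hI, e1, e2, e3, e4]

/-- RH-FREE. **Lemma 5.2 for `C²` data, at every `ρ > 1`**: for `ξ₁` of class `C²` on `[−1,1]` (cut
off outside; `D_uξ₁ = scaleDerivIn ξ₁`) and `η₁ ∈ C²(ℝ)`, the coefficient `k = cutCoeff ξ₁ η₁` is
differentiable near `ρ`, `r ↦ r k′(r)` is differentiable at `ρ`, and `(Qk)(ρ) = cutCoeffQ ξ₁ η₁ ρ` — the
twice-differentiability and the `Q`-identity read off seat gm-t16's `exists_contDiff_truncScalingCoeff` /
`opQ_truncScalingCoeff_eq` (`k = g ∘ log` on `[1,∞)` with `g ∈ C²(ℝ)`).  This is the form in which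
Lemma 5.2 is applied to the terms of (sonine0) in Prop. 5.3 (`ξ₁ = ψ_n^{tree}` is `C²` on `[−1,1]`,
`η₁ = cosTransform ψ_n ∈ C²`), and the engine of the discharge of the printed (smooth, `ρ ∈ (1,2]`)
statement below. [cite: ConnesConsani2021, Lemma 5.2 eq. (96) §5 p. 30 (arXiv item Lemma 29, chunk p0019:L77–L80)] -/
theorem mulOpQ_cutCoeff_of_contDiff (hξ₁ : ContDiffOn ℝ 2 ξ₁ (Icc (-1) 1)) (hη₁ : ContDiff ℝ 2 η₁)
    {ρ : ℝ} (hρ : 1 < ρ) :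
    DifferentiableAt ℝ (cutCoeff ξ₁ η₁) ρ ∧
      DifferentiableAt ℝ (fun r : ℝ => r • deriv (cutCoeff ξ₁ η₁) r) ρ ∧
        mulOpQ (cutCoeff ξ₁ η₁) ρ = cutCoeffQ ξ₁ η₁ ρ := by
  obtain ⟨g, hg, hgk, -, -, -, -⟩ := exists_contDiff_truncScalingCoeff hξ₁ hη₁
  have hρ0 : 0 < ρ := by linarith
  have hexph : ∀ r : ℝ, 0 < r → Real.exp (Real.log r / 2) = Real.sqrt r := fun r hr => by
    rw [Real.sqrt_eq_rpow, Real.rpow_def_of_pos hr]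
    congr 1
    ring
  have hexpn : ∀ r : ℝ, 0 < r → Real.exp (-Real.log r) = r⁻¹ := fun r hr => by
    rw [Real.exp_neg, Real.exp_log hr]
  -- `k = g ∘ log` on `[1, ∞)`
  have hkg : ∀ r : ℝ, 1 ≤ r → cutCoeff ξ₁ η₁ r = g (Real.log r) := by
    intro r hr
    have hr0 : 0 < r := by linarith
    rw [cutCoeff, hgk _ (Real.log_nonneg hr), hexph r hr0, hexpn r hr0, Real.exp_log hr0]
  have hloc : cutCoeff ξ₁ η₁ =ᶠ[𝓝 ρ] fun s => g (Real.log s) := by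
    filter_upwards [Ioi_mem_nhds hρ] with s hs using hkg s (le_of_lt hs)
  have hgd : ∀ y, HasDerivAt g (deriv g y) y := fun y =>
    (hg.differentiable (by norm_num) y).hasDerivAt
  have hg1 : ContDiff ℝ 1 (deriv g) := by
    rw [← one_add_one_eq_two] at hg
    exact hg.deriv'
  -- differentiability of `k` at `ρ`
  have hdk : DifferentiableAt ℝ (cutCoeff ξ₁ η₁) ρ := by
    refine hloc.differentiableAt_iff.2 ?_
    exact ((hgd _).comp ρ (Real.hasDerivAt_log hρ0.ne')).differentiableAt
  -- `k′(r) = g′(log r)/r` on `(1, ∞)`, so `r k′(r) = g′(log r)` near `ρ`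
  have hkd : ∀ r : ℝ, 1 < r → deriv (cutCoeff ξ₁ η₁) r = deriv g (Real.log r) * r⁻¹ := by
    intro r hr
    have hr0 : 0 < r := by linarith
    have hlocr : cutCoeff ξ₁ η₁ =ᶠ[𝓝 r] fun s => g (Real.log s) := by
      filter_upwards [Ioi_mem_nhds hr] with s hs using hkg s (le_of_lt hs)
    rw [hlocr.deriv_eq]
    have h := (hgd (Real.log r)).comp r (Real.hasDerivAt_log hr0.ne')
    simpa [Function.comp_def] using h.deriv
  have hloc2 : (fun r : ℝ => r • deriv (cutCoeff ξ₁ η₁) r) =ᶠ[𝓝 ρ]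
      fun r => deriv g (Real.log r) := by
    filter_upwards [Ioi_mem_nhds hρ] with s hs
    have hs0 : s ≠ 0 := by
      have : (1 : ℝ) < s := hs
      positivity
    rw [smul_eq_mul, hkd s hs]
    field_simp
  have hdk2 : DifferentiableAt ℝ (fun r : ℝ => r • deriv (cutCoeff ξ₁ η₁) r) ρ := by
    refine hloc2.differentiableAt_iff.2 ?_
    exact (((hg1.differentiable one_ne_zero) _).hasDerivAt.comp ρ
      (Real.hasDerivAt_log hρ0.ne')).differentiableAt
  refine ⟨hdk, hdk2, ?_⟩
  -- the identity is gm-t16's, up to `• = *` and `k/4 = ¼ k`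
  have h := opQ_truncScalingCoeff_eq hξ₁ hη₁ hρ
  have hcut : cutCoeff ξ₁ η₁ = fun r => Real.sqrt r * ∫ x in r⁻¹..1, ξ₁ x * η₁ (r * x) := rfl
  rw [mulOpQ, cutCoeffQ, hcut]
  simp only [smul_eq_mul] at h ⊢
  linarith [h]

/-- RH-FREE. **Connes–Consani 2021, Lemma 5.2 — DISCHARGED** (`theorem … : CC2021_lemma_5_2`): the
printed smooth data on `(0,1]` and `[1,∞)` are replaced, near `ρ ∈ (1,2]`, by `C²` data on `[−1,1]`
and `ℝ` (finite-order Whitney extension from `[¼,1]` and from `[1,∞)`,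
`Literature.Analysis.Calculus.exists_contDiff_extension_Icc_deriv` / `_Ici_deriv`) with the same
coefficient `k` on `(1,4)` and the same right-hand side, and the identity is seat gm-t16's proved
Lemma 5.2 (`ScalingCoeffBoundaryTerms.opQ_truncScalingCoeff_eq`, with the `C²` function
`exists_contDiff_truncScalingCoeff` giving the differentiability).  RH-FREE calculus.
[cite: ConnesConsani2021, Lemma 5.2 eq. (96) §5 pp. 29–30 (arXiv item Lemma 29, chunk p0019:L77–p0020:L55)] -/
theorem CC2021_lemma_5_2_holds : CC2021_lemma_5_2 := by
  intro ξ ζ hξ hζ ρ hρ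
  -- `C²` data: `ξ₁` from `[¼, 1] ⊆ (0, 1]`, `η₁` from `[1, ∞)`
  have hξ2 : ContDiffOn ℝ 2 ξ (Icc (1 / 4) 1) :=
    (hξ.of_le (WithTop.coe_le_coe.2 le_top)).mono fun x hx => ⟨by linarith [hx.1], hx.2⟩
  have hζ2 : ContDiffOn ℝ 2 ζ (Ici 1) := hζ.of_le (WithTop.coe_le_coe.2 le_top)
  obtain ⟨ξ₁, hξ₁, hξe, hξD⟩ :=
    exists_contDiff_extension_Icc_deriv (N := 2) one_le_two (by norm_num : (1 / 4 : ℝ) < 1) hξ2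
  obtain ⟨η₁, hη₁, hζe, hζD'⟩ := exists_contDiff_extension_Ici_deriv (N := 2) one_le_two hζ2
  have hζD : ∀ x, 1 < x → deriv η₁ x = deriv ζ x := by
    intro x hx
    rw [hζD' x (le_of_lt hx)]
    exact derivWithin_of_mem_nhds (Ici_mem_nhds hx)
  have hξ₁' : ContDiffOn ℝ 2 ξ₁ (Icc (-1) 1) := hξ₁.contDiffOn
  -- `k` agrees near `ρ`
  have hloc : cutCoeff ξ ζ =ᶠ[𝓝 ρ] cutCoeff ξ₁ η₁ := by
    have hmem : Ioo (1 : ℝ) 4 ∈ 𝓝 ρ := Ioo_mem_nhds hρ.1 (by linarith [hρ.2])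
    filter_upwards [hmem] with r hr using cutCoeff_congr_local hξe hζe hr
  obtain ⟨hd1, hd2, hQ⟩ := mulOpQ_cutCoeff_of_contDiff hξ₁' hη₁ hρ.1
  have hdloc : (fun r : ℝ => r • deriv (cutCoeff ξ ζ) r) =ᶠ[𝓝 ρ]
      fun r => r • deriv (cutCoeff ξ₁ η₁) r := by
    filter_upwards [hloc.deriv] with r hr
    rw [hr]
  refine ⟨hloc.differentiableAt_iff.2 hd1, hdloc.differentiableAt_iff.2 hd2, ?_⟩
  rw [cutCoeffQ_congr_local hξ₁ hξe hξD hζe hζD hρ, ← hQ, mulOpQ, mulOpQ, hdloc.deriv_eq,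
    hloc.self_of_nhds]

end Lemma52Discharge


/-! ## Discharge of Lemma 5.1 (`CC2021_lemma_5_1_holds`)

The printed proof ("`⟨η|ϑ(Qf)ξ⟩ = ∫ Qf(ρ⁻¹) k(ρ) d*ρ`, `Q(ρ^{1/2}ξ(ρx)) = −ρ^{1/2}(𝒟ξ)(ρx)`, integrate by
parts") is carried out on the kernel `(τ, v) ↦ F(τ) η̄(v) e^{−τ/2}ξ(e^{−τ}v)`: Fubini (the kernel is
integrable on `supp F × ℝ` because `η` and the dilates of `ξ`, `𝒟ξ` are square integrable), then for
each `v` two integrations by parts in `τ` against the `C²` function `G_v(τ) = e^{−τ/2}ξ(e^{−τ}v)`, whose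
second derivative is `¼G_v + e^{−τ/2}(𝒟ξ)(e^{−τ}v)` (chain rule: `∂_τ[e^{−τ/2}f(e^{−τ}v)] =
−½e^{−τ/2}f(e^{−τ}v) − e^{−τ/2}(D_uf)(e^{−τ}v)`), and Fubini back. -/

section Lemma51Discharge

variable {ξ η F : ℝ → ℂ}

/-- RH-FREE. The dilated function `e^{−τ/2} f(e^{−τ} v)` (the `v`-integrand of `scalingCoeff · f τ`).
Plumbing, private. [folklore] -/
private def dil (f : ℝ → ℂ) (τ v : ℝ) : ℂ :=
  ((Real.exp (-τ / 2) : ℝ) : ℂ) * f (Real.exp (-τ) * v)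

/-- RH-FREE. `D_u f (w) = w f′(w)` for a complex-valued function. Plumbing, private. [folklore] -/
private def duC (f : ℝ → ℂ) (w : ℝ) : ℂ := (w : ℂ) * deriv f w

/-- RH-FREE. `scalingCoeff η f τ = ∫ η̄(v) · dil f τ v dv`. [folklore] -/
private theorem scalingCoeff_eq_integral_dil (η f : ℝ → ℂ) (τ : ℝ) :
    scalingCoeff η f τ = ∫ v, conj (η v) * dil f τ v := rfl

/-- RH-FREE. **Chain rule for the dilation**: if `f` has derivative `f′` everywhere then
`∂_τ[e^{−τ/2}f(e^{−τ}v)] = −½e^{−τ/2}f(e^{−τ}v) − e^{−τ/2}(e^{−τ}v)f′(e^{−τ}v)` (the computation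
"`ρ∂_ρ(ρ^{1/2}ξ(ρx)) = ½ρ^{1/2}ξ(ρx) + ρ^{1/2}(D_uξ)(ρx)`" of the proof of Lemma 5.1, in `τ = −log ρ`).
[cite: ConnesConsani2021, Lemma 5.1 proof §5 p. 29 (arXiv chunk p0019:L36–L43)] -/
private theorem hasDerivAt_dil {f f' : ℝ → ℂ} (hf : ∀ w, HasDerivAt f (f' w) w) (τ v : ℝ) :
    HasDerivAt (fun t => dil f t v)
      (-(1 / 2) * dil f τ v - dil (fun w => (w : ℂ) * f' w) τ v) τ := by
  -- derivative of `τ ↦ e^{−τ/2}` and of `τ ↦ e^{−τ} v`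
  have h1 : HasDerivAt (fun t : ℝ => Real.exp (-t / 2)) (Real.exp (-τ / 2) * (-1 / 2)) τ := by
    have := ((hasDerivAt_id τ).neg.div_const 2).exp
    simpa using this
  have h1c : HasDerivAt (fun t : ℝ => ((Real.exp (-t / 2) : ℝ) : ℂ))
      (((Real.exp (-τ / 2) * (-1 / 2) : ℝ) : ℂ)) τ := h1.ofReal_comp
  have h2 : HasDerivAt (fun t : ℝ => Real.exp (-t) * v) (-(Real.exp (-τ) * v)) τ := by
    have := ((hasDerivAt_id τ).neg.exp.mul_const v)
    simpa using this
  have h3 : HasDerivAt (fun t : ℝ => f (Real.exp (-t) * v))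
      ((-(Real.exp (-τ) * v)) • f' (Real.exp (-τ) * v)) τ :=
    (hf (Real.exp (-τ) * v)).scomp τ h2
  have h := h1c.mul h3
  refine h.congr_deriv ?_
  simp only [dil, Complex.real_smul]
  push_cast
  ring

/-- RH-FREE. `D_u(D_uξ) + D_uξ = 𝒟ξ` for complex-valued `ξ` with `ξ′` differentiable (product rule).
[cite: ConnesConsani2021, §5 eq. (92) p. 29 (arXiv chunk p0019:L9–L16)] -/
private theorem duC_duC_add (hξ : Differentiable ℝ (deriv ξ)) (w : ℝ) :
    (w : ℂ) * deriv (duC ξ) w + duC ξ w = scaleOpD ξ w := by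
  have h := ((hasDerivAt_id w).ofReal_comp).mul (hξ w).hasDerivAt
  have hd := h.congr_of_eventuallyEq (f₁ := duC ξ) (Eventually.of_forall fun _ => rfl)
  rw [hd.deriv, duC, scaleOpD, Complex.real_smul, Complex.real_smul]
  simp only [id, Complex.ofReal_one, one_mul]
  push_cast
  ring

/-- RH-FREE. **The inner integration by parts**: for `F ∈ C_c^∞` and `ξ ∈ C³` (so that `𝒟ξ` is `C¹`),
`∫ (QF)(τ) e^{−τ/2}ξ(e^{−τ}v) dτ = −∫ F(τ) e^{−τ/2}(𝒟ξ)(e^{−τ}v) dτ` for every `v`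
("`Q(ρ^{1/2}ξ(ρx)) = −ρ^{1/2}(𝒟ξ)(ρx)`", self-adjointness of `Q`).
[cite: ConnesConsani2021, Lemma 5.1 proof §5 p. 29 (arXiv chunk p0019:L28–L66)] -/
private theorem integral_opQ_mul_dil (hF : IsWeilTest F) (hξ : ContDiff ℝ (⊤ : ℕ∞) ξ) (v : ℝ) :
    ∫ τ, opQ F τ * dil ξ τ v = -∫ τ, F τ * dil (scaleOpD ξ) τ v := by
  -- regularity of `F`
  have hF2 : ContDiff ℝ 2 F := hF.1.of_le (WithTop.coe_le_coe.2 le_top)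
  have hF1 : ContDiff ℝ 1 (deriv F) := by
    rw [← one_add_one_eq_two] at hF2
    exact hF2.deriv'
  have hFd : ∀ t, HasDerivAt F (deriv F t) t := fun t => (hF2.differentiable (by norm_num) t).hasDerivAt
  have hF'd : ∀ t, HasDerivAt (deriv F) (deriv (deriv F) t) t := fun t =>
    (hF1.differentiable one_ne_zero t).hasDerivAt
  have hFc : Continuous F := hF2.continuous
  have hF'c : Continuous (deriv F) := hF1.continuous
  have hF''c : Continuous (deriv (deriv F)) := hF1.continuous_deriv le_rfl
  have hFs : HasCompactSupport F := hF.2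
  have hF's : HasCompactSupport (deriv F) := hFs.deriv
  have hF''s : HasCompactSupport (deriv (deriv F)) := hFs.deriv.deriv
  -- regularity of `ξ`: `ξ, ξ′, ξ″` differentiable, `D_uξ`, `𝒟ξ` continuous
  have hξ3 : ContDiff ℝ 3 ξ := hξ.of_le (WithTop.coe_le_coe.2 le_top)
  have hξd : Differentiable ℝ ξ := hξ3.differentiable (by norm_num)
  have hξ2' : ContDiff ℝ 2 (deriv ξ) := by
    rw [show (3 : WithTop ℕ∞) = 2 + 1 by norm_num] at hξ3
    exact hξ3.deriv'
  have hξ'd : Differentiable ℝ (deriv ξ) := hξ2'.differentiable (by norm_num)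
  have hξ1'' : ContDiff ℝ 1 (deriv (deriv ξ)) := by
    rw [← one_add_one_eq_two] at hξ2'
    exact hξ2'.deriv'
  have hξ''d : Differentiable ℝ (deriv (deriv ξ)) := hξ1''.differentiable one_ne_zero
  have hdu_d : Differentiable ℝ (duC ξ) := fun w =>
    ((Complex.ofRealCLM.differentiable.differentiableAt).mul (hξ'd w))
  have hdu_eq : ∀ w, deriv (duC ξ) w = deriv ξ w + (w : ℂ) * deriv (deriv ξ) w := fun w => by
    have h := ((hasDerivAt_id w).ofReal_comp).mul (hξ'd w).hasDerivAt
    have hd := h.congr_of_eventuallyEq (f₁ := duC ξ) (Eventually.of_forall fun _ => rfl)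
    rw [hd.deriv]
    simp [id]
  have hdu'c : Continuous (deriv (duC ξ)) := by
    have : deriv (duC ξ) = fun w => deriv ξ w + (w : ℂ) * deriv (deriv ξ) w := funext hdu_eq
    rw [this]
    exact hξ2'.continuous.add (Complex.continuous_ofReal.mul hξ1''.continuous)
  -- the three dilated functions and their τ-derivatives
  set G : ℝ → ℂ := fun t => dil ξ t v with hG
  set H : ℝ → ℂ := fun t => dil (duC ξ) t v with hH
  set K : ℝ → ℂ := fun t => dil (fun w => (w : ℂ) * deriv (duC ξ) w) t v with hK
  have hGd : ∀ t, HasDerivAt G (-(1 / 2) * G t - H t) t := fun t =>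
    hasDerivAt_dil (fun w => (hξd w).hasDerivAt) t v
  have hHd : ∀ t, HasDerivAt H (-(1 / 2) * H t - K t) t := fun t =>
    hasDerivAt_dil (fun w => (hdu_d w).hasDerivAt) t v
  -- continuity in `τ`
  have hdil_cont : ∀ {f : ℝ → ℂ}, Continuous f → Continuous fun t => dil f t v := by
    intro f hf
    simp only [dil]
    exact (Complex.continuous_ofReal.comp (by fun_prop)).mul (hf.comp (by fun_prop))
  have hGc : Continuous G := hdil_cont hξ3.continuous
  have hHc : Continuous H := hdil_cont (Complex.continuous_ofReal.mul hξ2'.continuous)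
  have hKc : Continuous K := hdil_cont (Complex.continuous_ofReal.mul hdu'c)
  have hSc : Continuous fun t => dil (scaleOpD ξ) t v := by
    refine hdil_cont ?_
    change Continuous fun w : ℝ => (w ^ 2) • deriv (deriv ξ) w + (2 * w) • deriv ξ w
    exact ((continuous_id.pow 2).smul hξ1''.continuous).add
      ((continuous_const.mul continuous_id).smul hξ2'.continuous)
  -- `H + K = dil(𝒟ξ)`
  have hHK : ∀ t, H t + K t = dil (scaleOpD ξ) t v := by
    intro t
    simp only [hH, hK, dil]
    rw [← mul_add, add_comm, duC_duC_add hξ'd]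
  -- (i) `∫ F″ G = ∫ F G″` with `G″ = ¼ G + H + K`, via `W = F′G − F G′`, `∫ W′ = 0`
  have hW : ∀ t, HasDerivAt (fun s => deriv F s * G s - F s * (-(1 / 2) * G s - H s))
      (deriv (deriv F) t * G t - F t * ((1 / 4) * G t + H t + K t)) t := by
    intro t
    have hG' : HasDerivAt (fun s => -(1 / 2) * G s - H s)
        (-(1 / 2) * (-(1 / 2) * G t - H t) - (-(1 / 2) * H t - K t)) t :=
      ((hGd t).const_mul _).sub (hHd t)
    have h := ((hF'd t).mul (hGd t)).sub ((hFd t).mul hG')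
    refine h.congr_deriv ?_
    ring
  have hWint : Integrable fun t => deriv (deriv F) t * G t - F t * ((1 / 4) * G t + H t + K t) := by
    refine (Continuous.integrable_of_hasCompactSupport ?_ ?_)
    · exact (hF''c.mul hGc).sub (hFc.mul (((continuous_const.mul hGc).add hHc).add hKc))
    · exact (hF''s.mul_right).sub hFs.mul_right
  have hWs : Integrable fun s => deriv F s * G s - F s * (-(1 / 2) * G s - H s) := by
    refine Continuous.integrable_of_hasCompactSupport ?_ ?_
    · exact (hF'c.mul hGc).sub (hFc.mul ((continuous_const.mul hGc).sub hHc))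
    · exact hF's.mul_right.sub hFs.mul_right
  have hzero := integral_eq_zero_of_hasDerivAt_of_integrable hW hWint hWs
  -- (ii) assemble
  have hi1 : Integrable fun t => deriv (deriv F) t * G t :=
    (hF''c.mul hGc).integrable_of_hasCompactSupport hF''s.mul_right
  have hi2 : Integrable fun t => F t * ((1 / 4) * G t + H t + K t) :=
    (hFc.mul (((continuous_const.mul hGc).add hHc).add hKc)).integrable_of_hasCompactSupport
      hFs.mul_right
  have hi3 : Integrable fun t => F t * G t := (hFc.mul hGc).integrable_of_hasCompactSupport hFs.mul_right
  have hi4 : Integrable fun t => F t * dil (scaleOpD ξ) t v :=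
    (hFc.mul hSc).integrable_of_hasCompactSupport hFs.mul_right
  rw [MeasureTheory.integral_sub hi1 hi2, sub_eq_zero] at hzero
  have hsplit : (fun τ => opQ F τ * dil ξ τ v)
      = fun τ => -(deriv (deriv F) τ * G τ) + (1 / 4 : ℂ) * (F τ * G τ) := by
    funext τ
    simp only [opQ_apply, hG]
    ring
  have hi1n : Integrable fun τ => -(deriv (deriv F) τ * G τ) := hi1.neg
  have hi3c : Integrable fun τ => (1 / 4 : ℂ) * (F τ * G τ) := hi3.const_mul _
  have e2 : ∫ τ, F τ * ((1 / 4) * G τ + H τ + K τ)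
      = (1 / 4 : ℂ) * (∫ τ, F τ * G τ) + ∫ τ, F τ * dil (scaleOpD ξ) τ v := by
    rw [← MeasureTheory.integral_const_mul, ← MeasureTheory.integral_add hi3c hi4]
    refine integral_congr_ae (Eventually.of_forall fun t => ?_)
    dsimp only
    rw [← hHK t]
    ring
  rw [hsplit, MeasureTheory.integral_add hi1n hi3c, MeasureTheory.integral_neg,
    MeasureTheory.integral_const_mul, hzero, e2]
  ring

/-- RH-FREE. Square integrability is preserved by `v ↦ e^{−τ/2}f(e^{−τ}v)` (the scaling is unitary;
here only: integrability of `|·|²`, with `∫|e^{−τ/2}f(e^{−τ}v)|²dv = ∫|f|²`). [folklore] -/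
private theorem integrable_normSq_dil {f : ℝ → ℂ} (hf : MemLp f 2 volume) (hfc : Continuous f) (τ : ℝ) :
    Integrable (fun v => ‖dil f τ v‖ ^ 2) ∧
      ∫ v, ‖dil f τ v‖ ^ 2 = ∫ v, ‖f v‖ ^ 2 := by
  have hf2 : Integrable fun v => ‖f v‖ ^ 2 :=
    (memLp_two_iff_integrable_sq_norm hfc.aestronglyMeasurable).1 hf
  have hne : Real.exp (-τ) ≠ 0 := (Real.exp_pos _).ne'
  have hcomp : Integrable fun v => ‖f (Real.exp (-τ) * v)‖ ^ 2 := hf2.comp_mul_left' hne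
  have hsq : Real.exp (-τ / 2) ^ 2 = Real.exp (-τ) := by
    rw [← Real.exp_nat_mul]
    congr 1
    ring
  have hnorm : ∀ v, ‖dil f τ v‖ ^ 2 = Real.exp (-τ) * ‖f (Real.exp (-τ) * v)‖ ^ 2 := by
    intro v
    rw [dil, norm_mul, Complex.norm_real, Real.norm_eq_abs, abs_of_pos (Real.exp_pos _), mul_pow,
      hsq]
  simp_rw [hnorm]
  refine ⟨hcomp.const_mul _, ?_⟩
  rw [MeasureTheory.integral_const_mul, Measure.integral_comp_mul_left (fun v => ‖f v‖ ^ 2),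
    abs_of_pos (inv_pos.2 (Real.exp_pos _)), smul_eq_mul, ← mul_assoc, ← Real.exp_neg, neg_neg,
    ← Real.exp_add]
  simp

/-- RH-FREE. **Integrability of the kernel on `ℝ × ℝ`**: for `h` continuous of compact support,
`η ∈ L²` and `f ∈ L²` (both continuous), `(τ,v) ↦ h(τ) η̄(v) e^{−τ/2}f(e^{−τ}v)` is integrable
(Cauchy–Schwarz in `v`: `∫|η||f_τ| ≤ ½(‖η‖² + ‖f_τ‖²) = ½(‖η‖² + ‖f‖²)`, then compact support in `τ`).
[folklore] -/
private theorem integrable_kernel {h f : ℝ → ℂ} (hh : Continuous h) (hhs : HasCompactSupport h)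
    (hηc : Continuous η) (hη : MemLp η 2 volume) (hfc : Continuous f) (hf : MemLp f 2 volume) :
    Integrable (fun p : ℝ × ℝ => h p.1 * (conj (η p.2) * dil f p.1 p.2)) (volume.prod volume) := by
  have hη2 : Integrable fun v => ‖η v‖ ^ 2 :=
    (memLp_two_iff_integrable_sq_norm hηc.aestronglyMeasurable).1 hη
  -- continuity, hence measurability, of the kernel
  have hcont : Continuous fun p : ℝ × ℝ => h p.1 * (conj (η p.2) * dil f p.1 p.2) := by
    refine (hh.comp continuous_fst).mul ((Complex.continuous_conj.comp (hηc.comp continuous_snd)).mul ?_)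
    simp only [dil]
    exact (Complex.continuous_ofReal.comp (by fun_prop)).mul (hfc.comp (by fun_prop))
  rw [integrable_prod_iff hcont.aestronglyMeasurable]
  -- pointwise-in-`τ` bound `‖η v‖‖f_τ v‖ ≤ ½(‖η v‖² + ‖f_τ v‖²)`
  have hbd : ∀ τ v, ‖h τ * (conj (η v) * dil f τ v)‖
      ≤ ‖h τ‖ * ((‖η v‖ ^ 2 + ‖dil f τ v‖ ^ 2) / 2) := by
    intro τ v
    rw [norm_mul, norm_mul, Complex.norm_conj]
    refine mul_le_mul_of_nonneg_left ?_ (norm_nonneg _)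
    nlinarith [sq_nonneg (‖η v‖ - ‖dil f τ v‖), norm_nonneg (η v), norm_nonneg (dil f τ v)]
  have hslice : ∀ τ, Integrable fun v => h τ * (conj (η v) * dil f τ v) := by
    intro τ
    refine Integrable.mono' (((hη2.add (integrable_normSq_dil hf hfc τ).1).div_const 2).const_mul ‖h τ‖)
      ?_ (Eventually.of_forall (hbd τ))
    exact (hcont.comp (Continuous.prodMk_right τ)).aestronglyMeasurable
  refine ⟨Eventually.of_forall hslice, ?_⟩
  -- the `τ`-marginal is bounded by `‖h τ‖ · ½(‖η‖² + ‖f‖²)`, continuous with compact support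
  set C : ℝ := ((∫ v, ‖η v‖ ^ 2) + ∫ v, ‖f v‖ ^ 2) / 2 with hC
  refine Integrable.mono' ((hh.norm.mul continuous_const).integrable_of_hasCompactSupport
      (hhs.norm.mul_right) : Integrable fun τ => ‖h τ‖ * C) ?_ ?_
  · exact hcont.aestronglyMeasurable.norm.integral_prod_right'
  · refine Eventually.of_forall fun τ => ?_
    rw [Real.norm_eq_abs, abs_of_nonneg (integral_nonneg fun v => norm_nonneg _)]
    calc ∫ v, ‖h τ * (conj (η v) * dil f τ v)‖
        ≤ ∫ v, ‖h τ‖ * ((‖η v‖ ^ 2 + ‖dil f τ v‖ ^ 2) / 2) :=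
          integral_mono (hslice τ).norm
            (((hη2.add (integrable_normSq_dil hf hfc τ).1).div_const 2).const_mul ‖h τ‖) (hbd τ)
      _ = ‖h τ‖ * C := by
          rw [MeasureTheory.integral_const_mul, MeasureTheory.integral_div,
            MeasureTheory.integral_add hη2 (integrable_normSq_dil hf hfc τ).1,
            (integrable_normSq_dil hf hfc τ).2]

/-- RH-FREE. **Connes–Consani 2021, Lemma 5.1 — DISCHARGED** (`theorem … : CC2021_lemma_5_1`): Fubini on the
kernel `F(τ)η̄(v)e^{−τ/2}ξ(e^{−τ}v)` (integrable: `integrable_kernel`), the inner integration by parts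
`integral_opQ_mul_dil`, Fubini back.  Uses only `ξ ∈ C³`, `η` continuous, `ξ, 𝒟ξ, η ∈ L²` and
`F ∈ C_c^∞` among the fact's hypotheses (evenness and `D_uξ ∈ L²` are not needed).  RH-FREE calculus.
[cite: ConnesConsani2021, Lemma 5.1 eq. (94) §5 p. 29 (arXiv item Lemma 28, chunk p0019:L23–L68)] -/
theorem CC2021_lemma_5_1_holds : CC2021_lemma_5_1 := by
  intro ξ η hξ hη _ _ hξ2 hη2 _ hD2 F hF
  have hηc : Continuous η := hη.continuous
  have hξc : Continuous ξ := hξ.continuous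
  -- `𝒟ξ` is continuous
  have hξ3 : ContDiff ℝ 3 ξ := hξ.of_le (WithTop.coe_le_coe.2 le_top)
  have hξ2' : ContDiff ℝ 2 (deriv ξ) := by
    rw [show (3 : WithTop ℕ∞) = 2 + 1 by norm_num] at hξ3
    exact hξ3.deriv'
  have hξ1'' : ContDiff ℝ 1 (deriv (deriv ξ)) := by
    rw [← one_add_one_eq_two] at hξ2'
    exact hξ2'.deriv'
  have hDc : Continuous (scaleOpD ξ) := by
    change Continuous fun w : ℝ => (w ^ 2) • deriv (deriv ξ) w + (2 * w) • deriv ξ w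
    exact ((continuous_id.pow 2).smul hξ1''.continuous).add
      ((continuous_const.mul continuous_id).smul hξ2'.continuous)
  -- regularity of `F` and `opQ F`
  have hF2 : ContDiff ℝ 2 F := hF.1.of_le (WithTop.coe_le_coe.2 le_top)
  have hF1 : ContDiff ℝ 1 (deriv F) := by
    rw [← one_add_one_eq_two] at hF2
    exact hF2.deriv'
  have hQc : Continuous (opQ F) := by
    have h1 : Continuous (deriv (deriv F)) := hF1.continuous_deriv le_rfl
    show Continuous fun t => -deriv (deriv F) t + (1 / 4 : ℂ) * F t
    exact h1.neg.add (continuous_const.mul hF2.continuous)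
  have hQs : HasCompactSupport (opQ F) := by
    show HasCompactSupport fun t => -deriv (deriv F) t + (1 / 4 : ℂ) * F t
    exact hF.2.deriv.deriv.neg.add hF.2.mul_left
  -- Fubini twice around the inner integration by parts
  have hI1 := integrable_kernel hQc hQs hηc hη2 hξc hξ2
  have hI2 := integrable_kernel hF2.continuous hF.2 hηc hη2 hDc hD2
  calc ∫ τ, opQ F τ * scalingCoeff η ξ τ
      = ∫ τ, ∫ v, opQ F τ * (conj (η v) * dil ξ τ v) := by
        refine integral_congr_ae (Eventually.of_forall fun τ => ?_)
        dsimp only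
        rw [scalingCoeff_eq_integral_dil, ← MeasureTheory.integral_const_mul]
    _ = ∫ v, ∫ τ, opQ F τ * (conj (η v) * dil ξ τ v) := integral_integral_swap hI1
    _ = ∫ v, conj (η v) * -∫ τ, F τ * dil (scaleOpD ξ) τ v := by
        refine integral_congr_ae (Eventually.of_forall fun v => ?_)
        dsimp only
        rw [← integral_opQ_mul_dil hF hξ v, ← MeasureTheory.integral_const_mul]
        refine integral_congr_ae (Eventually.of_forall fun τ => ?_)
        dsimp only
        ring
    _ = -∫ v, ∫ τ, F τ * (conj (η v) * dil (scaleOpD ξ) τ v) := by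
        rw [← MeasureTheory.integral_neg]
        refine integral_congr_ae (Eventually.of_forall fun v => ?_)
        dsimp only
        rw [mul_neg, ← MeasureTheory.integral_const_mul]
        congr 1
        refine integral_congr_ae (Eventually.of_forall fun τ => ?_)
        dsimp only
        ring
    _ = -∫ τ, ∫ v, F τ * (conj (η v) * dil (scaleOpD ξ) τ v) := by
        rw [show (∫ v, ∫ τ, F τ * (conj (η v) * dil (scaleOpD ξ) τ v))
            = ∫ τ, ∫ v, F τ * (conj (η v) * dil (scaleOpD ξ) τ v) from
          integral_integral_swap hI2.swap]
    _ = -∫ τ, F τ * scalingCoeff η (scaleOpD ξ) τ := by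
        congr 1
        refine integral_congr_ae (Eventually.of_forall fun τ => ?_)
        dsimp only
        rw [scalingCoeff_eq_integral_dil, ← MeasureTheory.integral_const_mul]

end Lemma51Discharge

end Literature.NumberTheory.ConnesConsani2021

end
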